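import Literature.MathematicalPhysics.QuantumLattice.FermionBlockRGFluctuation

/-!
# Bałaban–O'Carroll–Schor, *Block renormalization group for Euclidean fermions*, §II: Lemma II.2,
# Lemma II.4 a)–h), Theorem II.1, Theorem II.2 and the DECOMPOSITION OF THE TWO-POINT FUNCTION
# (2.5) = §I (1.5)–(1.6), `D⁻¹ = Σ_{j<k} S_jΓ_jS̄_j^* + S_kD_k⁻¹S̄_k^*` — PROVED as finite-dimensional
# operator identities along the tree's fermionic block-RG tower (Dimock (46)–(48), (50)–(51))

statement-level skeleton of published theorems with citation tags; proofs where landed; nothing here is a claim about the Yang–Mills mass gap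

**Citation header (reproduction of PUBLISHED work).**
* T. Bałaban, M. O'Carroll, R. Schor, *Block renormalization group for Euclidean fermions*, Commun.
  Math. Phys. **122** (1989) 233–247 [BalabanOcarrollSchor1989] (held: `paper:doi-10-1007-bf01257414` =
  `paper:balaban1989-cmp122-bos-fermion-block-rg`, the Project Euclid open-access scan
  `euclid.cmp/1104178395`): §I p.234 (the display after (1.4)) and (1.5), p.235 (1.6); §II p.237
  (2.1)–(2.4), LEMMA II.2, LEMMA II.3, p.238 THEOREM II.1 a)–c), LEMMA II.4 a)–h) with its proof,
  p.239 THEOREM II.2 and (2.5).  **Legibility note.** Both held TEXT LAYERS of pp. 237–239 are OCR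
  débris for every display (recorded by seat p11 gen 18); the statements below were transcribed from
  the PAGE IMAGES of the same scan (PDF sha256 `5db72617…7395aed5`, pages rendered by the seat's
  pure-python CCITT-G4 decoder, seat folder `work/render/`), and every identity is in any case
  certified here by proof.  Writer seat p11 (literature-prover-lit-balaban-p11-g19-0), YM LIT SWEEP
  item (c), Lean lane; companion of the seat's `FermionBlockRGComposition.lean` (BOS Lemma II.1) and
  `FermionBlockRGFluctuation.lean` (Dimock (38)–(48), (50)–(51)).
* J. Dimock, *Quantum electrodynamics on the 3-torus. II*, arXiv:math-ph/0407063 (2004)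
  [Dimock2004QED3TorusII], §1.3.3–1.3.4 (46)–(48), (50)–(52) p.9 (`paper:arxiv-math-ph_0407063` p.9
  L1–58): the one-step flow whose tower (`flowD`, `flowGamma`, `flowH`, `flowHb`, `flowS`, `flowZ`)
  this file analyses, and p.9 L44–47: *"Balaban, O'Carroll, and Schor show for `A` on `𝕋^{−k}_{N+M−k}`
  that if `e_k|∂A|` is sufficiently small then `S_k(A), H_k(A), Γ_k(A)` all exist … For `A = 0` this can
  be found in [13]"* (= BOS).

**The printed statements (BOS, verbatim from the page images; `D ≡ D^{(0),ε}` the fine action,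
`Q_k` the `k`-fold block average with `Q_kQ_k^* = I`, `Q ≡` the one-step average,
`a_k = a(1 − L⁻¹)/(1 − L⁻ᵏ)`).**
p.237: *"Define `Z^{(k),L^kε}` and `D^{(k+1),L^{k+1}ε}` inductively by
`Z^{(k),L^kε} e^{(ψ̄,D^{(k+1),L^{k+1}ε}ψ)} ≡ T^{L^kε}_{a,L}(e^{(φ̄,D^{(k),L^kε}φ)})` (2.1), and let
`G^ε_k ≡ (D^{(0),ε} + a_k(L^kε)⁻¹Q_k^*Q_k)⁻¹` (2.2).  **Lemma II.2.**
`D^{(k),L^kε} = a_k(L^kε)⁻¹I − a_k²(L^kε)⁻²Q_kG^ε_kQ_k^*`.  Proof of Lemma II.2. By the inductive definition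
of `D^{(k),L^kε}` and the composition `T^{L^{k−1}ε}_{a,L}⋯T^{Lε}_{a,L}T^ε_{a,L} = T^ε_{a_k,L^k}`, we have
`Z^ε_k e^{(ψ̄,D^{(k),L^kε}ψ)} = T^ε_{a_k,L^k}(e^{(φ̄,D^{(0),ε}φ)})`. Performing the integral gives the result.
Define a fluctuation two-point function by the quadratic form in the integral in
`T^{L^kε}_{a,L}(e^{(φ̄,D^{(k),L^kε}φ)})` by `Γ^{(k),L^kε} ≡ (D^{(k),L^kε} + a(L^{k+1}ε)⁻¹Q^*Q)⁻¹` (2.3).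
… **Lemma II.3.** `D^{(k+1),L^{k+1}ε} = a(L^{k+1}ε)⁻¹ − a²(L^{k+1}ε)⁻²QΓ^{(k),L^kε}Q^*`. … By calculation
we find `T^ε_{a_k,L^k}(e^{(φ̄,D^{(0),ε}φ)+(φ̄,f)+(f̄,φ)})(ψ̄,ψ,f̄,f)
 ≡ Z^ε_k e^{(ψ̄,D^{(k),L^kε}ψ)} e^{a_k(L^kε)⁻¹[(ψ̄,Q_kG^ε_kf)+(f̄,G^ε_kQ_k^*ψ)]} e^{−(f̄,G^ε_kf)}` (2.4),
which defines `Z^ε_k`."*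
p.238: *"**Theorem II.1.** a) `Z^ε_{k+1} = Z^ε_kZ^{(k),L^kε}`, or in iterated form
`Z_k = Z^{(k−1),L^{k−1}ε}⋯Z^{(1),Lε}Z^{(0),ε}`.  b) `a_{k+1}(L^{k+1}ε)⁻¹Q_{k+1}G^ε_{k+1}
= a(L^{k+1}ε)⁻¹a_k(L^kε)⁻¹QΓ^{(k),L^kε}Q_kG^ε_k`, `a_{k+1}(L^{k+1}ε)⁻¹G^ε_{k+1}Q^*_{k+1}
= a(L^{k+1}ε)⁻¹a_k(L^kε)⁻¹G^ε_kQ^*_kΓ^{(k),L^kε}Q^*`.  c) `G^ε_{k+1} = a_k²(L^kε)⁻²G^ε_kQ^*_kΓ^{(k),L^kε}Q_kG^ε_k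
+ G^ε_k`, or in iterated form `G^ε_k = Σ_{j=1}^{k−1} a_j²(L^jε)⁻²G^ε_jQ^*_jΓ^{(j),L^jε}Q_jG^ε_j + Γ^{(0),ε}`.
We now establish other representations … **Lemma II.4.**
a) `G^ε_k = D^{(0),ε−1} − a_k(L^kε)⁻¹D^{(0),ε−1}Q^*_k(I + a_k(L^kε)⁻¹Q_kD^{(0),ε−1}Q^*_k)⁻¹Q_kD^{(0),ε−1}
 = D^{(0),ε−1} − D^{(0),ε−1}Q^*_kD^{(k),L^kε}Q_kD^{(0),ε−1}` (the minus sign of the second line is faint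
in the scan; it is forced by the first line and b)).  b) `D^{(k),L^kε} = a_k(L^kε)⁻¹(I + a_k(L^kε)⁻¹Q_kD^{(0),ε−1}Q^*_k)⁻¹`.
c) `D^{(k+1),L^{k+1}ε} = a(L^{k+1}ε)⁻¹(I + a(L^{k+1}ε)⁻¹QD^{(k),L^kε−1}Q^*)⁻¹`.
d) `Γ^{(k),L^kε} = D^{(k),L^kε−1} − D^{(k),L^kε−1}Q^*D^{(k+1),L^{k+1}ε}QD^{(k),L^kε−1}`.
e) `a_k(L^kε)⁻¹G^ε_kQ^*_k = D^{(0),ε−1}Q^*_kD^{(k),L^kε}`.  f) `a_k(L^kε)⁻¹Q_kG^ε_k = D^{(k),L^kε}Q_kD^{(0),ε−1}`.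
g) `D^{(0),ε−1}Q^*_{k+1}D^{(k+1),L^{k+1}ε} = a(L^{k+1}ε)⁻¹D^{(0),ε−1}Q^*_kD^{(k),L^kε}Γ^{(k),L^kε}Q^*`,
`a(L^{k+1}ε)⁻¹Γ^{(k),L^kε}Q^* = D^{(k),L^kε−1}Q^*D^{(k+1),L^{k+1}ε}`.
h) `D^{(k+1),L^{k+1}ε}Q_{k+1}D^{(0),ε−1} = a(L^{k+1}ε)⁻¹QΓ^{(k),L^kε}D^{(k),L^kε}Q_kD^{(0),ε−1}`,
`a(L^{k+1}ε)⁻¹QΓ^{(k),L^kε} = D^{(k+1),L^{k+1}ε}QD^{(k),L^kε−1}`.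
Proof of Lemma II.4 a) Letting `a′ = a_k(L^kε)⁻¹` and multiplying `(D^{(0),ε} + a′Q^*_kQ_k)f = g` on the
left by `Q_kD^{(0),ε−1}` gives `Q_kf = (I + a′Q_kD^{(0),ε−1}Q^*_k)⁻¹Q_kD^{(0),ε−1}g`. Substituting for `Q_kf`
above gives the first equality of the lemma; the 2nd follows from b); b) Substitute `G^ε_k` from the
first line of Lemma II.4 a) in Lemma II.2 and simplify. c) Using Lemma II.3 … the result follows as in
the proof of b), d) … as in the proof of a) the result follows using Lemma II.4c. e) Use Lemma II.4 a)
for `G^ε_k` and simplify. f) … similar to e). g) and h) express Theorem II.1b) in terms of Lemmas II.4e)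
and f)."*
p.239: *"**Theorem II.2.** `a_j²(L^jε)⁻²G^ε_jQ^*_jΓ^{(j),L^jε}Q_jG^ε_j = D^{(0),ε−1}Q^*_jD^{(j),L^jε}Q_jD^{(0),ε−1}
− D^{(0),ε−1}Q^*_{j+1}D^{(j+1),L^{j+1}ε}Q_{j+1}D^{(0),ε−1}`.  Proof of Theorem II.2 follows from Lemma II.4
d)–f).  We immediately obtain from Theorem II.1c, using Lemma II.4a for `G^ε_k`, the decomposition
formula `D^{(0),ε−1} = Σ_{j=0}^{k−1} (D^{(0),ε−1}Q^*_jD^{(j),L^jε}Q_jD^{(0),ε−1}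
− D^{(0),ε−1}Q^*_{j+1}D^{(j+1),L^{j+1}ε}Q_{j+1}D^{(0),ε−1}) + D^{(0),ε−1}Q^*_kD^{(k),L^kε}Q_kD^{(0),ε−1}` (2.5).
We note that the specific form of the individual terms can also be obtained by telescoping `G^ε_k` as
given by Lemma II.4a."*  §I p.234: *"then applying the RGT's we get a sequence of `L^kε` lattice
actions `D_k`, `k = 1,2,…` given by `D_k = a_k(L^kε)⁻¹(I + a_k(L^kε)⁻¹Q_kD⁻¹Q_k^*)⁻¹` … It turns out
that the overall structure of the decomposition of the two-point function `D⁻¹` is trivial; the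
decomposition is the telescopic sum (letting `D_0 = D` and `Q_0 = I`)"* (1.5) [= (2.5)], p.235:
*"which can be written `D⁻¹ = Σ_{j=0}^{k−1} S_jΓ_jS̄^*_j + S_kD_k⁻¹S̄^*_k` (1.6) where `S_i = D⁻¹Q^*_iD_i`,
`S̄^*_i = D_iQ_iD⁻¹` are `L^jε(ε)` to `ε(L^jε)` operators and `Γ_j = D_j⁻¹ − D_j⁻¹Q^*D_{j+1}QD_j⁻¹
= (D_j − a(L^{j+1}ε)⁻¹Q^*Q)⁻¹` a `L^jε` lattice operator"* [sic: §I prints `−a(L^{j+1}ε)⁻¹` here where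
(2.3) and Lemma II.4 c)–d) have `+`; the `+` sign is the one consistent with d), and is what is proved].

**Dictionary (tree ↔ BOS ↔ Dimock).**  Along the tree's tower of fermion lattices `𝓘 0, 𝓘 1, …`
(`FermionBlockRGComposition` §7, `FermionBlockRGFluctuation` §7) with one-step data `Q_j = Qs j`,
`Q̄_j = Qbs j` (BOS `Q`, `Q^*`; Dimock `Q_{e_j}(Q̃_jA)`, `Q_{e_j}(−Q̃_jA)ᵀ`), one-step weights
`c j` (BOS `a(L^{j+1}ε)⁻¹`; Dimock `b/L`) and fine action `D₀` (BOS `D ≡ D^{(0),ε}`; Dimock `D_{e_0}(A) + m_0`):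
`flowD k` = BOS `D^{(k),L^kε}` = §I `D_k` (its recursion IS Lemma II.3 = Dimock (47)₃); `flowGamma k` =
`Γ^{(k),L^kε}` (2.3) = Dimock `Γ_k` (46); `Qacc k`, `Qbacc k` = `Q_k`, `Q^*_k` (composites, `Q_0 = I`);
the accumulated inverse weight `accInvWeight c k = Σ_{j<k} (c j)⁻¹` = `(a_k(L^kε)⁻¹)⁻¹ = L^kε/a_k`
(BOS's `1/a_{k+1} = L⁻¹/a_k + 1/a` summed; `= 0` at `k = 0`, i.e. `a_0 = ∞`, matching `Q_0 = I`,
`D_0 = D`), so a COMPOSITE WEIGHT at level `k ≥ 1` is any `b` with `b · accInvWeight c k = 1`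
(`= bacc c (k−1)` of `FermionBlockRGComposition`, `bacc_mul_accInvWeight_succ`); `G^ε_k` (2.2) =
`fluctuationPropagator b (Qacc k) (Qbacc k) D₀`; `flowH k` = BOS `S_k = D⁻¹Q^*_kD_k` of (1.6)
`= a_k(L^kε)⁻¹G^ε_kQ^*_k` (II.4 e) = Dimock `H_k`; `flowHb k` = `S̄^*_k = D_kQ_kD⁻¹ = a_k(L^kε)⁻¹Q_kG^ε_k`
(II.4 f); `flowS k = Σ_{j<k} H_jΓ_jH̄_j` = Dimock `S_k` (50)–(51) = `Σ_{j<k} S_jΓ_jS̄^*_j` of (1.6)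
= `G^ε_k` (Theorem II.1 c) iterated).  Sign convention: the tree's densities are `e^{−ψ̄Dψ}` and
weights `e^{−c|χ−Qψ|²}` (Dimock), BOS's are `e^{+(ψ̄,Dψ)}`, `e^{+a(Lε)⁻¹(…)}`; the operator identities
are literally the same.

**What is here (kernel-checked, zero `sorry`, no new `Prop` definitions; pure matrix algebra over a
commutative ring `R`, plus three Grassmann-side corollaries).**  Standing hypotheses, all BOUNDED to
the levels used (BOS p.237: *"Various operator inverses will appear here and will be shown to exist in
the next section"*): `hD₀ : IsUnit D₀.det`; for `j < k`: `IsUnit (c j)`, `Qs j * Qbs j = 1`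
(*"`Q_kQ_k^* = I`"*) and `IsUnit (fluctuationOp (c j) (Qs j) (Qbs j) (flowD j)).det` (`Γ^{(j)}` exists).
FROM THESE the invertibility of every `D^{(k)}` (`isUnit_det_flowD`) and of `D + a_k(L^kε)⁻¹Q^*_kQ_k`
(`G^ε_k` exists, `isUnit_det_fluctuationOp_acc`) is DERIVED, not assumed.
* §1 one step, any `a, Q, Q̄, D` (next to the tree's `blockDirac_mul_avgPropagator` = II.4 c) one step):
  **II.4 d)** `inv_fluctuationOp_eq_sub` (`Γ = D⁻¹ − D⁻¹Q̄D₁QD⁻¹`, Mathlib's Woodbury identity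
  `Matrix.add_mul_mul_inv_eq_sub`), **II.4 g)₂/h)₂** `fluctShiftMat_eq` (`aΓQ̄ = D⁻¹Q̄D₁`, Dimock's `H`
  factor), `fluctShiftBarMat_eq` (`aQΓ = D₁QD⁻¹`).
* §2 `accInvWeight`, `accAvgPropagator k = (Σ_{j<k}c_j⁻¹)·1 + Q_kD₀⁻¹Q^*_k`, and **II.4 b) ∕ §I p.234 ∕
  c) iterated**: `flowD_mul_accAvgPropagator` (`D_k · (L^kε/a_k · I + Q_kD⁻¹Q^*_k) = 1`),
  `isUnit_det_flowD`, **`inv_flowD`** (`D_k⁻¹ = L^kε/a_k · I + Q_kD⁻¹Q^*_k`), `inv_flowD_succ` (c) inverse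
  form), `flowD_succ_eq_smul_inv` (**II.4 c) as printed**), `flowD_eq_smul_inv` (**II.4 b) as printed**).
* §3 **(2.2) + LEMMA II.2**: `isUnit_det_fluctuationOp_acc` (`G^ε_k` exists),
  **`flowD_eq_blockDirac_acc`**: `flowD k = blockDirac b (Qacc k) (Qbacc k) D₀ = b·1 − b²Q_kG^ε_kQ^*_k`
  for every composite weight `b` (`b · accInvWeight c k = 1`) — the `k`-step block action IS the one-step
  block action of the composite averages; with `b = bacc c k`: `flowD_succ_eq_blockDirac_bacc` (the data of
  `FermionBlockRGComposition.towerT_succ`, BOS's own route "(2.1) + Lemma II.1 ⇒ Lemma II.2";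
  `isUnit_bacc`, `bacc_mul_accInvWeight_succ`).
* §4 **II.4 e), f)**: `flowH_eq` (`H_k = D⁻¹Q^*_kD_k`), `flowHb_eq` (`H̄_k = D_kQ_kD⁻¹`), and with `G^ε_k`:
  `smul_fluctuationPropagator_acc_mul_Qbacc` (e) as printed), `smul_Qacc_mul_fluctuationPropagator_acc`
  (f) as printed), `flowH_eq_smul`, `flowHb_eq_smul`; **II.4 g)₁, h)₁**: `flowH_succ_eq`, `flowHb_succ_eq`.
* §5 **THEOREM II.2**: `flowH_mul_flowGamma_mul_flowHb` (tree form
  `H_jΓ_jH̄_j = D⁻¹Q^*_jD_jQ_jD⁻¹ − D⁻¹Q^*_{j+1}D_{j+1}Q_{j+1}D⁻¹`) and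
  `sq_smul_fluctuationPropagator_acc_conj_eq_sub` (as printed, with `G^ε_j`).
* §6 **(2.5) = (1.5)** `inv_eq_sum_range_sub_add` (the telescopic sum — hypothesis-free) and **(1.6)**
  **`inv_eq_flowS_add`: `D₀⁻¹ = flowS k + flowH k · (flowD k)⁻¹ · flowHb k`** — THE DECOMPOSITION OF THE
  TWO-POINT FUNCTION into the `k` fluctuation scales and the block field.
* §7 **II.4 a)** (`fluctuationPropagator_acc_eq_sub`, `…_sub'`: both lines) and **THEOREM II.1**: a)
  `flowZ_eq_prod`; b) `smul_Qacc_succ_mul_fluctuationPropagator_acc`,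
  `smul_fluctuationPropagator_acc_succ_mul_Qbacc`; c) `fluctuationPropagator_acc_one` (`G_1 = Γ^{(0)}`),
  `fluctuationPropagator_acc_succ` (one step) and **`fluctuationPropagator_acc_eq_flowS`** (iterated form:
  `G^ε_k = Σ_{j<k} H_jΓ_jH̄_j = flowS k` — Dimock's two descriptions of `S_k(A)`, (40) and (50), agree).
* §8 Grassmann side (`[Algebra ℚ R]`): **(2.1) iterated** `towerT_grassmannExp_quadratic`
  (`T_{c_{k−1}}⋯T_{c_0}(e^{−ψ̄D₀ψ}) = flowZ k • e^{−χ̄ (flowD k) χ}`), the display of the proof of Lemma II.2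
  `fermionBlockRG_acc_grassmannExp_quadratic`
  (`T_{bacc k, Q_{k+1}, Q^*_{k+1}}(e^{−ψ̄D₀ψ}) = ε det(−(G^ε_{k+1})⁻¹) • e^{−χ̄ D_{k+1} χ}`), and **(2.4) in the
  tree's conventions** `iterGeneratingFn_eq_generatingFn_acc` (the `k`-fold generating function (44) with
  the data in closed form: `H_k = a_kG_kQ^*_k`, `H̄_k = a_kQ_kG_k`, `S_k = G^ε_k`); (v1.1) **THEOREM II.1 a)
  IN SUBSTANCE** `accConst_mul_eq_flowZ`: the constant of the COMPOSITE transformation — `accConst k` of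
  `FermionBlockRGComposition.towerT_succ` times `ε₀ det(−(D₀ + bacc k·Q^*_{k+1}Q_{k+1}))` (BOS's `Z^ε_{k+1}`
  of (2.4), up to the tree's normalisations) — EQUALS the product `flowZ (k+1)` of the one-step constants
  (BOS's `Z^{(k)}⋯Z^{(0)}`), by comparing `towerT_succ` with `towerT_grassmannExp_quadratic` on the
  Gaussian and cancelling the unit `e^{−χ̄D_{k+1}χ}`.

**Design ∕ honest scope.** (i) BOS prove Lemma II.2 by the composite Gaussian integral and Lemma II.4
by operator manipulations; here II.4 b)∕c) come first (induction on the tree's one-step Woodbury lemma)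
and Lemma II.2 follows by uniqueness of two-sided inverses of `accAvgPropagator k` — a shorter road in
the tree; the Grassmann reading is recovered in §8.  (ii) BOS's `Q^*` is the adjoint for the Riemann-sum
inner products; here `Q̄_j` is a free matrix with `Q_jQ̄_j = 1` (so Dimock's gauge-covariant case (42) is
covered), and the lattice-spacing factors `(L^kε)⁻¹` are absorbed into the weights `c j`, `b` as in the
two companion files.  (iii) Not here: §III (exponential decay of the kernels, (3.1)–(3.5)), §IV, the
continuum limits (1.9)–(1.11), and the multi-field representation (1.8).

Mathlib: `Matrix.add_mul_mul_inv_eq_sub` (Woodbury), `Matrix.det_add_mul` (matrix determinant lemma),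
`Matrix.inv_eq_left_inv ∕ inv_eq_right_inv`, `Finset.sum_range_sub'`; the tree: `WilsonFermionBlockAveraging`
(`fluctuationOp`, `blockDirac`, `fluctuationPropagator`, `blockDirac_mul_avgPropagator`,
`fermionBlockRG_grassmannExp_quadratic`), `FermionBlockRGComposition` (`Qacc`, `Qbacc`, `bacc`, `towerT`),
`FermionBlockRGFluctuation` (`flowD`, `flowGamma`, `flowH`, `flowHb`, `flowS`, `flowZ`, `fluctShiftMat`,
`fluctShiftBarMat`, `generatingFn`, `iterGeneratingFn_eq_generatingFn`), `GrassmannGaussianChargeRule`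
(`isNilpotent_quadratic`).
(v1.0 p338586 = §§1–8, seat p11 gen 19; v1.1 = the same text with `accConst_mul_eq_flowZ` and one private
cancellation lemma appended to §8 and this docstring extended — no declaration changed or removed.)
-/

noncomputable section

open Finset Matrix

namespace Literature.MathematicalPhysics.QuantumLattice

section QLatticeAQFT

/-! ### §1 One step: Lemma II.4 d), g)₂, h)₂ for arbitrary `a, Q, Q̄, D` -/

section OneStep

variable {R : Type*} [CommRing R] {m n : Type*} [LinearOrder m] [Fintype m] [LinearOrder n] [Fintype n]

/-- **BOS Lemma II.4 d), one block-spin step with arbitrary data** (`D` = `D^{(k)}`, `a` = `a(L^{k+1}ε)⁻¹`,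
`D₁ = blockDirac a Q Q̄ D` = `D^{(k+1)}`): *"`Γ^{(k),L^kε} = D^{(k),L^kε−1} − D^{(k),L^kε−1}Q^*D^{(k+1),L^{k+1}ε}QD^{(k),L^kε−1}`"*,
i.e. `(D + aQ̄Q)⁻¹ = D⁻¹ − D⁻¹Q̄D₁QD⁻¹` — the Woodbury identity with `(a⁻¹·1 + QD⁻¹Q̄)⁻¹ = D₁` (the tree's
`blockDirac_mul_avgPropagator` = II.4 c)), for `a`, `D`, `D + aQ̄Q` invertible. [cite: BalabanOcarrollSchor1989, §II Lemma II.4 d) p.238] -/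
theorem inv_fluctuationOp_eq_sub {a : R} (ha : IsUnit a) (Q : Matrix n m R) (Qb : Matrix m n R)
    {D : Matrix m m R} (hD : IsUnit D.det) (hF : IsUnit (fluctuationOp a Q Qb D).det) :
    (fluctuationOp a Q Qb D)⁻¹ = D⁻¹ - D⁻¹ * Qb * blockDirac a Q Qb D * Q * D⁻¹ := by
  obtain ⟨u, rfl⟩ := ha
  have hP : blockDirac (u : R) Q Qb D * (((u⁻¹ : Rˣ) : R) • 1 + Q * D⁻¹ * Qb) = 1 := by
    simpa only [Ring.inverse_unit] using blockDirac_mul_avgPropagator u.isUnit Q Qb hD hF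
  have hPinv : (((u⁻¹ : Rˣ) : R) • (1 : Matrix n n R) + Q * D⁻¹ * Qb)⁻¹ = blockDirac (u : R) Q Qb D :=
    Matrix.inv_eq_left_inv hP
  have hC : IsUnit ((u : R) • (1 : Matrix n n R)) :=
    ⟨⟨(u : R) • 1, ((u⁻¹ : Rˣ) : R) • 1, by simp [smul_smul], by simp [smul_smul]⟩, rfl⟩
  have hCinv : ((u : R) • (1 : Matrix n n R))⁻¹ = ((u⁻¹ : Rˣ) : R) • 1 :=
    Matrix.inv_eq_left_inv (by simp [smul_smul])
  have hAC : IsUnit (((u : R) • (1 : Matrix n n R))⁻¹ + Q * D⁻¹ * Qb) := by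
    rw [hCinv, Matrix.isUnit_iff_isUnit_det]
    exact Matrix.isUnit_det_of_left_inverse hP
  have hW := Matrix.add_mul_mul_inv_eq_sub D Qb ((u : R) • (1 : Matrix n n R)) Q
    ((Matrix.isUnit_iff_isUnit_det _).2 hD) hC hAC
  rw [hCinv, hPinv] at hW
  have hFeq : fluctuationOp (u : R) Q Qb D = D + Qb * ((u : R) • (1 : Matrix n n R)) * Q := by
    rw [fluctuationOp, Matrix.mul_smul, Matrix.mul_one, Matrix.smul_mul]
  rw [hFeq, hW]

/-- The step behind II.4 g)₂: `(D + aQ̄Q) · (D⁻¹Q̄D₁) = aQ̄`, from `D₁(a⁻¹·1 + QD⁻¹Q̄) = 1`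
(BOS: *"g) and h) express Theorem II.1b) in terms of Lemmas II.4e) and f)"*). [cite: BalabanOcarrollSchor1989, §II Lemma II.4 g) p.238] -/
theorem fluctuationOp_mul_inv_mul_conjAvg_mul_blockDirac {a : R} (ha : IsUnit a) (Q : Matrix n m R)
    (Qb : Matrix m n R) {D : Matrix m m R} (hD : IsUnit D.det)
    (hF : IsUnit (fluctuationOp a Q Qb D).det) :
    fluctuationOp a Q Qb D * (D⁻¹ * Qb * blockDirac a Q Qb D) = a • Qb := by
  obtain ⟨u, rfl⟩ := ha
  have hP : (((u⁻¹ : Rˣ) : R) • 1 + Q * D⁻¹ * Qb) * blockDirac (u : R) Q Qb D = 1 := by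
    rw [mul_eq_one_comm]
    simpa only [Ring.inverse_unit] using blockDirac_mul_avgPropagator u.isUnit Q Qb hD hF
  have hP' : Q * D⁻¹ * Qb * blockDirac (u : R) Q Qb D =
      1 - ((u⁻¹ : Rˣ) : R) • blockDirac (u : R) Q Qb D := by
    rw [Matrix.add_mul, Matrix.smul_mul, Matrix.one_mul] at hP
    rw [← hP]; abel
  calc fluctuationOp (u : R) Q Qb D * (D⁻¹ * Qb * blockDirac (u : R) Q Qb D)
      = D * D⁻¹ * Qb * blockDirac (u : R) Q Qb D +
          (u : R) • (Qb * (Q * D⁻¹ * Qb * blockDirac (u : R) Q Qb D)) := by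
        rw [fluctuationOp, Matrix.add_mul, Matrix.smul_mul]
        simp only [Matrix.mul_assoc]
    _ = (u : R) • Qb := by
        rw [Matrix.mul_nonsing_inv _ hD, Matrix.one_mul, hP', Matrix.mul_sub, Matrix.mul_one,
          Matrix.mul_smul, smul_sub, smul_smul, Units.mul_inv, one_smul]
        abel

/-- **BOS Lemma II.4 g), second line, one step with arbitrary data**:
*"`a(L^{k+1}ε)⁻¹Γ^{(k),L^kε}Q^* = D^{(k),L^kε−1}Q^*D^{(k+1),L^{k+1}ε}`"* — the tree's shift matrix
`fluctShiftMat a Q Q̄ D = a(D + aQ̄Q)⁻¹Q̄` (Dimock's `H` factor `c_kΓ_kQ̄_k` of (46)) equals `D⁻¹Q̄D₁`.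
[cite: BalabanOcarrollSchor1989, §II Lemma II.4 g) p.238] -/
theorem fluctShiftMat_eq {a : R} (ha : IsUnit a) (Q : Matrix n m R)
    (Qb : Matrix m n R) {D : Matrix m m R} (hD : IsUnit D.det)
    (hF : IsUnit (fluctuationOp a Q Qb D).det) :
    FermionBlockRG.fluctShiftMat R a Q Qb D = D⁻¹ * Qb * blockDirac a Q Qb D := by
  rw [FermionBlockRG.fluctShiftMat, ← Matrix.mul_smul,
    ← fluctuationOp_mul_inv_mul_conjAvg_mul_blockDirac ha Q Qb hD hF, ← Matrix.mul_assoc,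
    Matrix.nonsing_inv_mul _ hF, Matrix.one_mul]

/-- The step behind II.4 h)₂: `(D₁QD⁻¹) · (D + aQ̄Q) = aQ`. [cite: BalabanOcarrollSchor1989, §II Lemma II.4 h) p.238] -/
theorem blockDirac_mul_avg_mul_inv_mul_fluctuationOp {a : R} (ha : IsUnit a) (Q : Matrix n m R)
    (Qb : Matrix m n R) {D : Matrix m m R} (hD : IsUnit D.det)
    (hF : IsUnit (fluctuationOp a Q Qb D).det) :
    blockDirac a Q Qb D * Q * D⁻¹ * fluctuationOp a Q Qb D = a • Q := by
  obtain ⟨u, rfl⟩ := ha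
  have hP : blockDirac (u : R) Q Qb D * (((u⁻¹ : Rˣ) : R) • 1 + Q * D⁻¹ * Qb) = 1 := by
    simpa only [Ring.inverse_unit] using blockDirac_mul_avgPropagator u.isUnit Q Qb hD hF
  have hP' : blockDirac (u : R) Q Qb D * Q * D⁻¹ * Qb =
      1 - ((u⁻¹ : Rˣ) : R) • blockDirac (u : R) Q Qb D := by
    rw [Matrix.mul_add, Matrix.mul_smul, Matrix.mul_one] at hP
    rw [← hP]; simp only [Matrix.mul_assoc]; abel
  calc blockDirac (u : R) Q Qb D * Q * D⁻¹ * fluctuationOp (u : R) Q Qb D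
      = blockDirac (u : R) Q Qb D * Q * (D⁻¹ * D) +
          (u : R) • (blockDirac (u : R) Q Qb D * Q * D⁻¹ * Qb * Q) := by
        rw [fluctuationOp, Matrix.mul_add, Matrix.mul_smul]
        simp only [Matrix.mul_assoc]
    _ = (u : R) • Q := by
        rw [Matrix.nonsing_inv_mul _ hD, Matrix.mul_one, hP', Matrix.sub_mul, Matrix.one_mul,
          Matrix.smul_mul, smul_sub, smul_smul, Units.mul_inv, one_smul]
        abel

/-- **BOS Lemma II.4 h), second line, one step with arbitrary data**:
*"`a(L^{k+1}ε)⁻¹QΓ^{(k),L^kε} = D^{(k+1),L^{k+1}ε}QD^{(k),L^kε−1}`"* — the tree's conjugate shift matrix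
`fluctShiftBarMat a Q Q̄ D = aQ(D + aQ̄Q)⁻¹` equals `D₁QD⁻¹`. [cite: BalabanOcarrollSchor1989, §II Lemma II.4 h) p.238] -/
theorem fluctShiftBarMat_eq {a : R} (ha : IsUnit a) (Q : Matrix n m R)
    (Qb : Matrix m n R) {D : Matrix m m R} (hD : IsUnit D.det)
    (hF : IsUnit (fluctuationOp a Q Qb D).det) :
    FermionBlockRG.fluctShiftBarMat R a Q Qb D = blockDirac a Q Qb D * Q * D⁻¹ := by
  rw [FermionBlockRG.fluctShiftBarMat, ← Matrix.smul_mul,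
    ← blockDirac_mul_avg_mul_inv_mul_fluctuationOp ha Q Qb hD hF,
    Matrix.mul_assoc _ (fluctuationOp _ _ _ _), Matrix.mul_nonsing_inv _ hF, Matrix.mul_one]

end OneStep

namespace FermionBlockRG

open GrassmannAlgebra ExteriorAlgebra

variable (R : Type*) [CommRing R]
variable (𝓘 : ℕ → Type*) [∀ k, LinearOrder (𝓘 k)] [∀ k, Fintype (𝓘 k)]
variable (c : ℕ → R) (Qs : (k : ℕ) → Matrix (𝓘 (k + 1)) (𝓘 k) R)
  (Qbs : (k : ℕ) → Matrix (𝓘 k) (𝓘 (k + 1)) R) (D₀ : Matrix (𝓘 0) (𝓘 0) R)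

/-! ### §2 The accumulated inverse weight and Lemma II.4 b), c) -/

/-- **The accumulated inverse weight** `Σ_{j<k} (c j)⁻¹` after `k` block-spin steps with one-step
weights `c j` (`Ring.inverse`, so `= 0` termwise unless the `c j` are units): BOS's
`(a_k(L^kε)⁻¹)⁻¹ = L^kε/a_k`, the relation *"`(1/a_{k+1}) = (L⁻¹/a_k) + 1/a`"* of Lemma II.1 summed
from `1/a_0 = 0` (`Q_0 = I`, `D_0 = D`). [cite: BalabanOcarrollSchor1989, §II Lemma II.1 p.237] -/
def accInvWeight (c : ℕ → R) (k : ℕ) : R := ∑ j ∈ Finset.range k, Ring.inverse (c j)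

/-- No step, no smearing: `accInvWeight c 0 = 0` (`1/a_0 = 0`). [cite: BalabanOcarrollSchor1989, §II Lemma II.1 p.237] -/
theorem accInvWeight_zero : accInvWeight R c 0 = 0 := by simp [accInvWeight]

/-- One more step adds `1/c_k`: BOS's *"`(1/a_{k+1}) = (L⁻¹/a_k) + 1/a`"* in the units of this file.
[cite: BalabanOcarrollSchor1989, §II Lemma II.1 p.237] -/
theorem accInvWeight_succ (k : ℕ) :
    accInvWeight R c (k + 1) = accInvWeight R c k + Ring.inverse (c k) := by
  simp [accInvWeight, Finset.sum_range_succ]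

/-- **The averaged fine propagator plus accumulated white noise**
`(Σ_{j<k} c_j⁻¹)·1 + Q_kD₀⁻¹Q^*_k` — the inverse of `D^{(k)}` (Lemma II.4 b) in inverse form,
`inv_flowD`); BOS's `a_k(L^kε)⁻¹(I + a_k(L^kε)⁻¹Q_kD^{(0),ε−1}Q^*_k)` is `D^{(k)}` as the inverse of it.
[cite: BalabanOcarrollSchor1989, §II Lemma II.4 b) p.238] -/
def accAvgPropagator (k : ℕ) : Matrix (𝓘 k) (𝓘 k) R :=
  accInvWeight R c k • (1 : Matrix (𝓘 k) (𝓘 k) R) + Qacc R 𝓘 Qs k * D₀⁻¹ * Qbacc R 𝓘 Qbs k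

/-- At `k = 0` (`Q_0 = I`, no noise) the averaged propagator is `D₀⁻¹` itself. [cite: BalabanOcarrollSchor1989, §I (1.5) p.234] -/
theorem accAvgPropagator_zero : accAvgPropagator R 𝓘 c Qs Qbs D₀ 0 = D₀⁻¹ := by
  simp [accAvgPropagator, accInvWeight_zero, Qacc, Qbacc]

/-- One-step recursion of the averaged propagator (uses `Q_kQ̄_k = 1`):
`P_{k+1} = c_k⁻¹·1 + Q_kP_kQ̄_k`. [cite: BalabanOcarrollSchor1989, §II Lemma II.4 b)–c) p.238] -/
theorem accAvgPropagator_succ (k : ℕ) (hQ : Qs k * Qbs k = 1) :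
    accAvgPropagator R 𝓘 c Qs Qbs D₀ (k + 1) =
      Ring.inverse (c k) • (1 : Matrix (𝓘 (k + 1)) (𝓘 (k + 1)) R) +
        Qs k * accAvgPropagator R 𝓘 c Qs Qbs D₀ k * Qbs k := by
  simp only [accAvgPropagator, accInvWeight_succ, Qacc, Qbacc, Matrix.mul_add, Matrix.add_mul,
    Matrix.mul_smul, Matrix.smul_mul, Matrix.mul_one, hQ, add_smul, Matrix.mul_assoc]
  abel

/-- **BOS Lemma II.4 b) (inverse form) ∕ c) iterated — `D^{(k)}` inverts the averaged propagator**: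
`flowD k · ((Σ_{j<k}c_j⁻¹)·1 + Q_kD₀⁻¹Q^*_k) = 1`, by induction on `k`, each step the tree's one-step
Woodbury lemma `blockDirac_mul_avgPropagator` (= II.4 c)) and `Q_kQ̄_k = 1`; hypotheses only for the
levels `j < k`. [cite: BalabanOcarrollSchor1989, §II Lemma II.4 b)–c) p.238] -/
theorem flowD_mul_accAvgPropagator (k : ℕ) (hD₀ : IsUnit D₀.det) (hc : ∀ j < k, IsUnit (c j))
    (hQ : ∀ j < k, Qs j * Qbs j = 1)
    (hF : ∀ j < k, IsUnit (fluctuationOp (c j) (Qs j) (Qbs j) (flowD R 𝓘 c Qs Qbs D₀ j)).det) :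
    flowD R 𝓘 c Qs Qbs D₀ k * accAvgPropagator R 𝓘 c Qs Qbs D₀ k = 1 := by
  induction k with
  | zero => rw [accAvgPropagator_zero, flowD, Matrix.mul_nonsing_inv _ hD₀]
  | succ k ih =>
    have ih' := ih (fun j hj => hc j (by omega)) (fun j hj => hQ j (by omega))
      (fun j hj => hF j (by omega))
    have hDk : IsUnit (flowD R 𝓘 c Qs Qbs D₀ k).det := Matrix.isUnit_det_of_right_inverse ih'
    have hinv : (flowD R 𝓘 c Qs Qbs D₀ k)⁻¹ = accAvgPropagator R 𝓘 c Qs Qbs D₀ k :=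
      Matrix.inv_eq_right_inv ih'
    rw [accAvgPropagator_succ R 𝓘 c Qs Qbs D₀ k (hQ k (by omega)), ← hinv, flowD]
    exact blockDirac_mul_avgPropagator (hc k (by omega)) (Qs k) (Qbs k) hDk (hF k (by omega))

/-- **Every block action `D^{(k)}` is invertible** (BOS p.237: *"Various operator inverses will appear
here and will be shown to exist"*; here derived from the invertibility of `D₀` and of the one-step
fluctuation operators). [cite: BalabanOcarrollSchor1989, §II Lemma II.4 b) p.238] -/
theorem isUnit_det_flowD (k : ℕ) (hD₀ : IsUnit D₀.det) (hc : ∀ j < k, IsUnit (c j))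
    (hQ : ∀ j < k, Qs j * Qbs j = 1)
    (hF : ∀ j < k, IsUnit (fluctuationOp (c j) (Qs j) (Qbs j) (flowD R 𝓘 c Qs Qbs D₀ j)).det) :
    IsUnit (flowD R 𝓘 c Qs Qbs D₀ k).det :=
  Matrix.isUnit_det_of_right_inverse (flowD_mul_accAvgPropagator R 𝓘 c Qs Qbs D₀ k hD₀ hc hQ hF)

/-- **BOS Lemma II.4 b), inverse form: `(D^{(k)})⁻¹ = L^kε/a_k · I + Q_kD⁻¹Q^*_k`** — the block
propagator after `k` steps is the `k`-fold averaged fine propagator plus the accumulated Gaussian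
noise `Σ_{j<k} c_j⁻¹`. [cite: BalabanOcarrollSchor1989, §II Lemma II.4 b) p.238] -/
theorem inv_flowD (k : ℕ) (hD₀ : IsUnit D₀.det) (hc : ∀ j < k, IsUnit (c j))
    (hQ : ∀ j < k, Qs j * Qbs j = 1)
    (hF : ∀ j < k, IsUnit (fluctuationOp (c j) (Qs j) (Qbs j) (flowD R 𝓘 c Qs Qbs D₀ j)).det) :
    (flowD R 𝓘 c Qs Qbs D₀ k)⁻¹ =
      accInvWeight R c k • (1 : Matrix (𝓘 k) (𝓘 k) R) + Qacc R 𝓘 Qs k * D₀⁻¹ * Qbacc R 𝓘 Qbs k :=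
  Matrix.inv_eq_right_inv (flowD_mul_accAvgPropagator R 𝓘 c Qs Qbs D₀ k hD₀ hc hQ hF)

/-- The averaged propagator is also a left inverse of `D^{(k)}`. [cite: BalabanOcarrollSchor1989, §II Lemma II.4 b) p.238] -/
theorem accAvgPropagator_mul_flowD (k : ℕ) (hD₀ : IsUnit D₀.det) (hc : ∀ j < k, IsUnit (c j))
    (hQ : ∀ j < k, Qs j * Qbs j = 1)
    (hF : ∀ j < k, IsUnit (fluctuationOp (c j) (Qs j) (Qbs j) (flowD R 𝓘 c Qs Qbs D₀ j)).det) :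
    accAvgPropagator R 𝓘 c Qs Qbs D₀ k * flowD R 𝓘 c Qs Qbs D₀ k = 1 :=
  mul_eq_one_comm.1 (flowD_mul_accAvgPropagator R 𝓘 c Qs Qbs D₀ k hD₀ hc hQ hF)

/-- **BOS Lemma II.4 c), inverse form (one step)**: `(D^{(k+1)})⁻¹ = c_k⁻¹·1 + Q(D^{(k)})⁻¹Q^*`
(the tree's one-step lemma read as an inverse). [cite: BalabanOcarrollSchor1989, §II Lemma II.4 c) p.238] -/
theorem inv_flowD_succ (k : ℕ) (hc : IsUnit (c k)) (hDk : IsUnit (flowD R 𝓘 c Qs Qbs D₀ k).det)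
    (hF : IsUnit (fluctuationOp (c k) (Qs k) (Qbs k) (flowD R 𝓘 c Qs Qbs D₀ k)).det) :
    (flowD R 𝓘 c Qs Qbs D₀ (k + 1))⁻¹ =
      Ring.inverse (c k) • (1 : Matrix (𝓘 (k + 1)) (𝓘 (k + 1)) R) +
        Qs k * (flowD R 𝓘 c Qs Qbs D₀ k)⁻¹ * Qbs k :=
  Matrix.inv_eq_right_inv (blockDirac_mul_avgPropagator hc (Qs k) (Qbs k) hDk hF)

/-- **BOS Lemma II.4 c) as printed**: *"`D^{(k+1),L^{k+1}ε} = a(L^{k+1}ε)⁻¹(I + a(L^{k+1}ε)⁻¹QD^{(k),L^kε−1}Q^*)⁻¹`"*.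
[cite: BalabanOcarrollSchor1989, §II Lemma II.4 c) p.238] -/
theorem flowD_succ_eq_smul_inv (k : ℕ) (hc : IsUnit (c k))
    (hDk : IsUnit (flowD R 𝓘 c Qs Qbs D₀ k).det)
    (hF : IsUnit (fluctuationOp (c k) (Qs k) (Qbs k) (flowD R 𝓘 c Qs Qbs D₀ k)).det) :
    flowD R 𝓘 c Qs Qbs D₀ (k + 1) =
      c k • (1 + c k • (Qs k * (flowD R 𝓘 c Qs Qbs D₀ k)⁻¹ * Qbs k))⁻¹ := by
  obtain ⟨u, hu⟩ := hc
  have h1 := blockDirac_mul_avgPropagator (u.isUnit) (Qs k) (Qbs k) hDk (hu ▸ hF)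
  rw [Ring.inverse_unit] at h1
  have h2 : ((u⁻¹ : Rˣ) : R) • flowD R 𝓘 c Qs Qbs D₀ (k + 1) *
      (1 + c k • (Qs k * (flowD R 𝓘 c Qs Qbs D₀ k)⁻¹ * Qbs k)) = 1 := by
    rw [flowD, ← hu, Matrix.smul_mul, ← Matrix.mul_smul, smul_add, smul_smul, Units.inv_mul,
      one_smul]
    exact h1
  rw [Matrix.inv_eq_left_inv h2, smul_smul, ← hu, Units.mul_inv, one_smul]

/-- **BOS Lemma II.4 b) as printed ∕ §I p.234**: *"`D_k = a_k(L^kε)⁻¹(I + a_k(L^kε)⁻¹Q_kD⁻¹Q^*_k)⁻¹`"*,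
for every composite weight `b` of level `k` (`b · Σ_{j<k}c_j⁻¹ = 1`, i.e. `b = a_k(L^kε)⁻¹`).
[cite: BalabanOcarrollSchor1989, §II Lemma II.4 b) p.238] -/
theorem flowD_eq_smul_inv (k : ℕ) {b : R} (hb : b * accInvWeight R c k = 1) (hD₀ : IsUnit D₀.det)
    (hc : ∀ j < k, IsUnit (c j)) (hQ : ∀ j < k, Qs j * Qbs j = 1)
    (hF : ∀ j < k, IsUnit (fluctuationOp (c j) (Qs j) (Qbs j) (flowD R 𝓘 c Qs Qbs D₀ j)).det) :
    flowD R 𝓘 c Qs Qbs D₀ k = b • (1 + b • (Qacc R 𝓘 Qs k * D₀⁻¹ * Qbacc R 𝓘 Qbs k))⁻¹ := by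
  obtain ⟨u, rfl⟩ := IsUnit.of_mul_eq_one _ hb
  have h1 := flowD_mul_accAvgPropagator R 𝓘 c Qs Qbs D₀ k hD₀ hc hQ hF
  have h2 : ((u⁻¹ : Rˣ) : R) • flowD R 𝓘 c Qs Qbs D₀ k *
      (1 + (u : R) • (Qacc R 𝓘 Qs k * D₀⁻¹ * Qbacc R 𝓘 Qbs k)) = 1 := by
    have : (1 : Matrix (𝓘 k) (𝓘 k) R) + (u : R) • (Qacc R 𝓘 Qs k * D₀⁻¹ * Qbacc R 𝓘 Qbs k) =
        (u : R) • accAvgPropagator R 𝓘 c Qs Qbs D₀ k := by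
      rw [accAvgPropagator, smul_add, smul_smul, hb, one_smul]
    rw [this, Matrix.smul_mul, Matrix.mul_smul, smul_smul, Units.inv_mul, one_smul, h1]
  rw [Matrix.inv_eq_left_inv h2, smul_smul, Units.mul_inv, one_smul]

/-! ### §3 (2.2) and Lemma II.2: the `k`-step block action is one composite step -/

/-- `I + bQ_kD₀⁻¹Q^*_k = b · accAvgPropagator k` for a composite weight `b`. [cite: BalabanOcarrollSchor1989, §II Lemma II.4 a)–b) p.238] -/
private theorem one_add_smul_eq_smul_accAvgPropagator (k : ℕ) {b : R}
    (hb : b * accInvWeight R c k = 1) :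
    (1 : Matrix (𝓘 k) (𝓘 k) R) + b • (Qacc R 𝓘 Qs k * D₀⁻¹ * Qbacc R 𝓘 Qbs k) =
      b • accAvgPropagator R 𝓘 c Qs Qbs D₀ k := by
  rw [accAvgPropagator, smul_add, smul_smul, hb, one_smul]

/-- **(2.2): the composite fluctuation propagator `G^ε_k = (D + a_k(L^kε)⁻¹Q^*_kQ_k)⁻¹` exists** —
`det(D₀ + bQ^*_kQ_k) = det D₀ · b^{|𝓘 k|} · det(accAvgPropagator k)` is a unit (matrix determinant lemma
`Matrix.det_add_mul` and §2), for every composite weight `b` of level `k`. [cite: BalabanOcarrollSchor1989, §II (2.2) p.237] -/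
theorem isUnit_det_fluctuationOp_acc (k : ℕ) {b : R} (hb : b * accInvWeight R c k = 1)
    (hD₀ : IsUnit D₀.det) (hc : ∀ j < k, IsUnit (c j)) (hQ : ∀ j < k, Qs j * Qbs j = 1)
    (hF : ∀ j < k, IsUnit (fluctuationOp (c j) (Qs j) (Qbs j) (flowD R 𝓘 c Qs Qbs D₀ j)).det) :
    IsUnit (fluctuationOp b (Qacc R 𝓘 Qs k) (Qbacc R 𝓘 Qbs k) D₀).det := by
  have hu : IsUnit b := IsUnit.of_mul_eq_one _ hb
  have hP : IsUnit (accAvgPropagator R 𝓘 c Qs Qbs D₀ k).det :=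
    Matrix.isUnit_det_of_left_inverse (flowD_mul_accAvgPropagator R 𝓘 c Qs Qbs D₀ k hD₀ hc hQ hF)
  rw [fluctuationOp, ← Matrix.smul_mul, Matrix.det_add_mul _ _ hD₀, Matrix.mul_smul,
    one_add_smul_eq_smul_accAvgPropagator R 𝓘 c Qs Qbs D₀ k hb, Matrix.det_smul]
  exact hD₀.mul ((hu.pow _).mul hP)

/-- **BOS LEMMA II.2: `D^{(k),L^kε} = a_k(L^kε)⁻¹I − a_k²(L^kε)⁻²Q_kG^ε_kQ^*_k`** — in the tree's words,
the `k`-step block action `flowD k` IS the ONE-step block Dirac operator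
`blockDirac b (Qacc k) (Qbacc k) D₀ = b·1 − b²Q_k(D₀ + bQ^*_kQ_k)⁻¹Q^*_k` of the composite averages with
the composite weight `b` (`b · Σ_{j<k}c_j⁻¹ = 1`).  BOS: *"Performing the integral gives the result"*;
here: both sides are two-sided inverses of `accAvgPropagator k` (§2 and the one-step lemma for the
composite data). [cite: BalabanOcarrollSchor1989, §II Lemma II.2 p.237] -/
theorem flowD_eq_blockDirac_acc (k : ℕ) {b : R} (hb : b * accInvWeight R c k = 1)
    (hD₀ : IsUnit D₀.det) (hc : ∀ j < k, IsUnit (c j)) (hQ : ∀ j < k, Qs j * Qbs j = 1)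
    (hF : ∀ j < k, IsUnit (fluctuationOp (c j) (Qs j) (Qbs j) (flowD R 𝓘 c Qs Qbs D₀ j)).det) :
    flowD R 𝓘 c Qs Qbs D₀ k = blockDirac b (Qacc R 𝓘 Qs k) (Qbacc R 𝓘 Qbs k) D₀ := by
  obtain ⟨u, rfl⟩ := IsUnit.of_mul_eq_one _ hb
  have h1 := blockDirac_mul_avgPropagator u.isUnit (Qacc R 𝓘 Qs k) (Qbacc R 𝓘 Qbs k) hD₀
    (isUnit_det_fluctuationOp_acc R 𝓘 c Qs Qbs D₀ k hb hD₀ hc hQ hF)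
  have hinv : Ring.inverse (u : R) = accInvWeight R c k := by
    rw [Ring.inverse_unit]; exact Units.inv_eq_of_mul_eq_one_right hb
  have h1' : blockDirac (u : R) (Qacc R 𝓘 Qs k) (Qbacc R 𝓘 Qbs k) D₀ *
      accAvgPropagator R 𝓘 c Qs Qbs D₀ k = 1 := by
    rw [accAvgPropagator, ← hinv]; exact h1
  have h2 := flowD_mul_accAvgPropagator R 𝓘 c Qs Qbs D₀ k hD₀ hc hQ hF
  calc flowD R 𝓘 c Qs Qbs D₀ k = (accAvgPropagator R 𝓘 c Qs Qbs D₀ k)⁻¹ :=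
        (Matrix.inv_eq_left_inv h2).symm
    _ = _ := Matrix.inv_eq_left_inv h1'

/-- The accumulated weight `bacc c k` of `FermionBlockRGComposition` (the weight of the composite
transformation after `k + 1` steps, `towerT_succ`) is a unit when the `c j` (`j ≤ k`) and the
`bacc c j + c (j+1)` (`j < k`) are. [cite: BalabanOcarrollSchor1989, §II Lemma II.1 p.237] -/
theorem isUnit_bacc (k : ℕ) (hc : ∀ j ≤ k, IsUnit (c j))
    (hbc : ∀ j < k, IsUnit (bacc R c j + c (j + 1))) : IsUnit (bacc R c k) := by
  induction k with
  | zero => rw [bacc]; exact hc 0 le_rfl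
  | succ k ih =>
    rw [bacc]
    exact ((hc (k + 1) le_rfl).mul (ih (fun j hj => hc j (by omega))
      (fun j hj => hbc j (by omega)))).mul (hbc k (by omega)).ringInverse

/-- **`bacc c k` is a composite weight of level `k + 1`: `bacc c k · Σ_{j≤k} c_j⁻¹ = 1`** — BOS's
*"`(1/a_{k+1}) = (L⁻¹/a_k) + 1/a` with solution `a_k = a(1 − L⁻¹)/(1 − L⁻ᵏ)`"* in the tree's two
parametrisations (harmonic recursion `bacc` vs. the sum of inverse weights). [cite: BalabanOcarrollSchor1989, §II Lemma II.1 p.237] -/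
theorem bacc_mul_accInvWeight_succ (k : ℕ) (hc : ∀ j ≤ k, IsUnit (c j))
    (hbc : ∀ j < k, IsUnit (bacc R c j + c (j + 1))) :
    bacc R c k * accInvWeight R c (k + 1) = 1 := by
  induction k with
  | zero =>
    rw [bacc, accInvWeight_succ, accInvWeight_zero, zero_add, Ring.mul_inverse_cancel _ (hc 0 le_rfl)]
  | succ k ih =>
    have hb := isUnit_bacc R c k (fun j hj => hc j (by omega)) (fun j hj => hbc j (by omega))
    have ih' := ih (fun j hj => hc j (by omega)) (fun j hj => hbc j (by omega))
    obtain ⟨ub, hub⟩ := hb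
    obtain ⟨uc, huc⟩ := hc (k + 1) le_rfl
    obtain ⟨us, hus⟩ := hbc k (by omega)
    rw [accInvWeight_succ, bacc]
    have hw : accInvWeight R c (k + 1) = ((ub⁻¹ : Rˣ) : R) := by
      rw [← hub] at ih'
      exact (Units.inv_eq_of_mul_eq_one_right ih').symm
    rw [hw, ← hub, ← huc]
    have hsum : (ub : R) + (uc : R) = us := by rw [hus, hub, huc]
    rw [hsum, Ring.inverse_unit, Ring.inverse_unit]
    have : (uc : R) * (ub : R) * ((us⁻¹ : Rˣ) : R) * (((ub⁻¹ : Rˣ) : R) + ((uc⁻¹ : Rˣ) : R)) =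
        ((us⁻¹ : Rˣ) : R) * ((uc : R) * ((ub : R) * ((ub⁻¹ : Rˣ) : R)) +
          (ub : R) * ((uc : R) * ((uc⁻¹ : Rˣ) : R))) := by ring
    rw [this, Units.mul_inv, Units.mul_inv, mul_one, mul_one, add_comm, hsum, Units.inv_mul]

/-- **Lemma II.2 in the data of `FermionBlockRGComposition.towerT_succ`**: after `k + 1` steps
`flowD (k+1) = blockDirac (bacc c k) (Qacc (k+1)) (Qbacc (k+1)) D₀` — the block action produced by the
composite transformation `T_{bacc k, Q_{k+1}, Q^*_{k+1}}` (BOS: *"By the inductive definition of `D^{(k)}`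
and the composition `T⋯T = T_{a_k,L^k}` … Performing the integral gives the result"*).
[cite: BalabanOcarrollSchor1989, §II Lemma II.2 p.237] -/
theorem flowD_succ_eq_blockDirac_bacc (k : ℕ) (hD₀ : IsUnit D₀.det) (hc : ∀ j ≤ k, IsUnit (c j))
    (hbc : ∀ j < k, IsUnit (bacc R c j + c (j + 1))) (hQ : ∀ j ≤ k, Qs j * Qbs j = 1)
    (hF : ∀ j ≤ k, IsUnit (fluctuationOp (c j) (Qs j) (Qbs j) (flowD R 𝓘 c Qs Qbs D₀ j)).det) :
    flowD R 𝓘 c Qs Qbs D₀ (k + 1) =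
      blockDirac (bacc R c k) (Qacc R 𝓘 Qs (k + 1)) (Qbacc R 𝓘 Qbs (k + 1)) D₀ :=
  flowD_eq_blockDirac_acc R 𝓘 c Qs Qbs D₀ (k + 1) (bacc_mul_accInvWeight_succ R c k hc hbc) hD₀
    (fun j hj => hc j (by omega)) (fun j hj => hQ j (by omega)) (fun j hj => hF j (by omega))

/-! ### §4 Lemma II.4 e), f), g)₁, h)₁: the source couplings in closed form -/

/-- **BOS Lemma II.4 e) ∕ (1.6): `H_k = S_k = D⁻¹Q^*_kD_k`** — the tree's source coupling `flowH k`
(Dimock's `H_k`, the product of the one-step factors `c_jΓ_jQ̄_j`) in closed form, by induction with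
g)₂ (`fluctShiftMat_eq`) and `D_jD_j⁻¹ = 1`. [cite: BalabanOcarrollSchor1989, §II Lemma II.4 e) p.238] -/
theorem flowH_eq (k : ℕ) (hD₀ : IsUnit D₀.det) (hc : ∀ j < k, IsUnit (c j))
    (hQ : ∀ j < k, Qs j * Qbs j = 1)
    (hF : ∀ j < k, IsUnit (fluctuationOp (c j) (Qs j) (Qbs j) (flowD R 𝓘 c Qs Qbs D₀ j)).det) :
    flowH R 𝓘 c Qs Qbs D₀ k = D₀⁻¹ * Qbacc R 𝓘 Qbs k * flowD R 𝓘 c Qs Qbs D₀ k := by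
  induction k with
  | zero => rw [flowH, Qbacc, flowD, Matrix.mul_one, Matrix.nonsing_inv_mul _ hD₀]
  | succ k ih =>
    have hc' : ∀ j < k, IsUnit (c j) := fun j hj => hc j (by omega)
    have hQ' : ∀ j < k, Qs j * Qbs j = 1 := fun j hj => hQ j (by omega)
    have hF' : ∀ j < k,
        IsUnit (fluctuationOp (c j) (Qs j) (Qbs j) (flowD R 𝓘 c Qs Qbs D₀ j)).det :=
      fun j hj => hF j (by omega)
    have hDk := isUnit_det_flowD R 𝓘 c Qs Qbs D₀ k hD₀ hc' hQ' hF'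
    rw [flowH, ih hc' hQ' hF',
      fluctShiftMat_eq (hc k (by omega)) (Qs k) (Qbs k) hDk (hF k (by omega)), Qbacc, ← flowD]
    simp only [Matrix.mul_assoc]
    rw [Matrix.mul_nonsing_inv_cancel_left _ _ hDk]

/-- **BOS Lemma II.4 f) ∕ (1.6): `H̄_k = S̄^*_k = D_kQ_kD⁻¹`** — the conjugate source coupling `flowHb k`
in closed form. [cite: BalabanOcarrollSchor1989, §II Lemma II.4 f) p.238] -/
theorem flowHb_eq (k : ℕ) (hD₀ : IsUnit D₀.det) (hc : ∀ j < k, IsUnit (c j))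
    (hQ : ∀ j < k, Qs j * Qbs j = 1)
    (hF : ∀ j < k, IsUnit (fluctuationOp (c j) (Qs j) (Qbs j) (flowD R 𝓘 c Qs Qbs D₀ j)).det) :
    flowHb R 𝓘 c Qs Qbs D₀ k = flowD R 𝓘 c Qs Qbs D₀ k * Qacc R 𝓘 Qs k * D₀⁻¹ := by
  induction k with
  | zero => rw [flowHb, Qacc, flowD, Matrix.mul_one, Matrix.mul_nonsing_inv _ hD₀]
  | succ k ih =>
    have hc' : ∀ j < k, IsUnit (c j) := fun j hj => hc j (by omega)
    have hQ' : ∀ j < k, Qs j * Qbs j = 1 := fun j hj => hQ j (by omega)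
    have hF' : ∀ j < k,
        IsUnit (fluctuationOp (c j) (Qs j) (Qbs j) (flowD R 𝓘 c Qs Qbs D₀ j)).det :=
      fun j hj => hF j (by omega)
    have hDk := isUnit_det_flowD R 𝓘 c Qs Qbs D₀ k hD₀ hc' hQ' hF'
    rw [flowHb, ih hc' hQ' hF',
      fluctShiftBarMat_eq (hc k (by omega)) (Qs k) (Qbs k) hDk (hF k (by omega)), Qacc, ← flowD]
    simp only [Matrix.mul_assoc]
    rw [Matrix.nonsing_inv_mul_cancel_left _ _ hDk]

/-- **BOS Lemma II.4 e) as printed: `a_k(L^kε)⁻¹G^ε_kQ^*_k = D^{(0),ε−1}Q^*_kD^{(k),L^kε}`**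
(`b` a composite weight of level `k`; g)₂ for the composite data and Lemma II.2). [cite: BalabanOcarrollSchor1989, §II Lemma II.4 e) p.238] -/
theorem smul_fluctuationPropagator_acc_mul_Qbacc (k : ℕ) {b : R} (hb : b * accInvWeight R c k = 1)
    (hD₀ : IsUnit D₀.det) (hc : ∀ j < k, IsUnit (c j)) (hQ : ∀ j < k, Qs j * Qbs j = 1)
    (hF : ∀ j < k, IsUnit (fluctuationOp (c j) (Qs j) (Qbs j) (flowD R 𝓘 c Qs Qbs D₀ j)).det) :
    b • (fluctuationPropagator b (Qacc R 𝓘 Qs k) (Qbacc R 𝓘 Qbs k) D₀ * Qbacc R 𝓘 Qbs k) =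
      D₀⁻¹ * Qbacc R 𝓘 Qbs k * flowD R 𝓘 c Qs Qbs D₀ k := by
  have hu : IsUnit b := IsUnit.of_mul_eq_one _ hb
  have hFa := isUnit_det_fluctuationOp_acc R 𝓘 c Qs Qbs D₀ k hb hD₀ hc hQ hF
  have h := fluctShiftMat_eq (R := R) hu (Qacc R 𝓘 Qs k) (Qbacc R 𝓘 Qbs k) hD₀ hFa
  rw [FermionBlockRG.fluctShiftMat,
    ← flowD_eq_blockDirac_acc R 𝓘 c Qs Qbs D₀ k hb hD₀ hc hQ hF] at h
  rw [fluctuationPropagator, h]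

/-- **BOS Lemma II.4 f) as printed: `a_k(L^kε)⁻¹Q_kG^ε_k = D^{(k),L^kε}Q_kD^{(0),ε−1}`**.
[cite: BalabanOcarrollSchor1989, §II Lemma II.4 f) p.238] -/
theorem smul_Qacc_mul_fluctuationPropagator_acc (k : ℕ) {b : R} (hb : b * accInvWeight R c k = 1)
    (hD₀ : IsUnit D₀.det) (hc : ∀ j < k, IsUnit (c j)) (hQ : ∀ j < k, Qs j * Qbs j = 1)
    (hF : ∀ j < k, IsUnit (fluctuationOp (c j) (Qs j) (Qbs j) (flowD R 𝓘 c Qs Qbs D₀ j)).det) :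
    b • (Qacc R 𝓘 Qs k * fluctuationPropagator b (Qacc R 𝓘 Qs k) (Qbacc R 𝓘 Qbs k) D₀) =
      flowD R 𝓘 c Qs Qbs D₀ k * Qacc R 𝓘 Qs k * D₀⁻¹ := by
  have hu : IsUnit b := IsUnit.of_mul_eq_one _ hb
  have hFa := isUnit_det_fluctuationOp_acc R 𝓘 c Qs Qbs D₀ k hb hD₀ hc hQ hF
  have h := fluctShiftBarMat_eq (R := R) hu (Qacc R 𝓘 Qs k) (Qbacc R 𝓘 Qbs k) hD₀ hFa
  rw [FermionBlockRG.fluctShiftBarMat,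
    ← flowD_eq_blockDirac_acc R 𝓘 c Qs Qbs D₀ k hb hD₀ hc hQ hF] at h
  rw [fluctuationPropagator, h]

/-- **`H_k = a_k(L^kε)⁻¹G^ε_kQ^*_k`** — the tree's `flowH k` is BOS's `S_k` of (2.4)∕(1.6), by e).
[cite: BalabanOcarrollSchor1989, §II Lemma II.4 e), (2.4) pp.237–238] -/
theorem flowH_eq_smul (k : ℕ) {b : R} (hb : b * accInvWeight R c k = 1)
    (hD₀ : IsUnit D₀.det) (hc : ∀ j < k, IsUnit (c j)) (hQ : ∀ j < k, Qs j * Qbs j = 1)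
    (hF : ∀ j < k, IsUnit (fluctuationOp (c j) (Qs j) (Qbs j) (flowD R 𝓘 c Qs Qbs D₀ j)).det) :
    flowH R 𝓘 c Qs Qbs D₀ k =
      b • (fluctuationPropagator b (Qacc R 𝓘 Qs k) (Qbacc R 𝓘 Qbs k) D₀ * Qbacc R 𝓘 Qbs k) := by
  rw [smul_fluctuationPropagator_acc_mul_Qbacc R 𝓘 c Qs Qbs D₀ k hb hD₀ hc hQ hF,
    flowH_eq R 𝓘 c Qs Qbs D₀ k hD₀ hc hQ hF]

/-- **`H̄_k = a_k(L^kε)⁻¹Q_kG^ε_k`** — the tree's `flowHb k` is BOS's `S̄^*_k`, by f).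
[cite: BalabanOcarrollSchor1989, §II Lemma II.4 f), (2.4) pp.237–238] -/
theorem flowHb_eq_smul (k : ℕ) {b : R} (hb : b * accInvWeight R c k = 1)
    (hD₀ : IsUnit D₀.det) (hc : ∀ j < k, IsUnit (c j)) (hQ : ∀ j < k, Qs j * Qbs j = 1)
    (hF : ∀ j < k, IsUnit (fluctuationOp (c j) (Qs j) (Qbs j) (flowD R 𝓘 c Qs Qbs D₀ j)).det) :
    flowHb R 𝓘 c Qs Qbs D₀ k =
      b • (Qacc R 𝓘 Qs k * fluctuationPropagator b (Qacc R 𝓘 Qs k) (Qbacc R 𝓘 Qbs k) D₀) := by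
  rw [smul_Qacc_mul_fluctuationPropagator_acc R 𝓘 c Qs Qbs D₀ k hb hD₀ hc hQ hF,
    flowHb_eq R 𝓘 c Qs Qbs D₀ k hD₀ hc hQ hF]

/-- **BOS Lemma II.4 g), first line: `D⁻¹Q^*_{k+1}D^{(k+1)} = a(L^{k+1}ε)⁻¹ D⁻¹Q^*_kD^{(k)}Γ^{(k)}Q^*`**
(= the recursion `H_{k+1} = H_k · c_kΓ_kQ̄_k` of the tree's `flowH`, written with e)).
[cite: BalabanOcarrollSchor1989, §II Lemma II.4 g) p.238] -/
theorem flowH_succ_eq (k : ℕ) (hD₀ : IsUnit D₀.det) (hc : ∀ j ≤ k, IsUnit (c j))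
    (hQ : ∀ j ≤ k, Qs j * Qbs j = 1)
    (hF : ∀ j ≤ k, IsUnit (fluctuationOp (c j) (Qs j) (Qbs j) (flowD R 𝓘 c Qs Qbs D₀ j)).det) :
    D₀⁻¹ * Qbacc R 𝓘 Qbs (k + 1) * flowD R 𝓘 c Qs Qbs D₀ (k + 1) =
      c k • (D₀⁻¹ * Qbacc R 𝓘 Qbs k * flowD R 𝓘 c Qs Qbs D₀ k * flowGamma R 𝓘 c Qs Qbs D₀ k *
        Qbs k) := by
  rw [← flowH_eq R 𝓘 c Qs Qbs D₀ (k + 1) hD₀ (fun j hj => hc j (by omega))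
      (fun j hj => hQ j (by omega)) (fun j hj => hF j (by omega)), flowH,
    flowH_eq R 𝓘 c Qs Qbs D₀ k hD₀ (fun j hj => hc j (by omega)) (fun j hj => hQ j (by omega))
      (fun j hj => hF j (by omega)), FermionBlockRG.fluctShiftMat, flowGamma, Matrix.mul_smul]
  simp only [Matrix.mul_assoc]

/-- **BOS Lemma II.4 h), first line: `D^{(k+1)}Q_{k+1}D⁻¹ = a(L^{k+1}ε)⁻¹ QΓ^{(k)}D^{(k)}Q_kD⁻¹`**
(= the recursion `H̄_{k+1} = c_kQ_kΓ_k · H̄_k` of the tree's `flowHb`, written with f)).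
[cite: BalabanOcarrollSchor1989, §II Lemma II.4 h) p.238] -/
theorem flowHb_succ_eq (k : ℕ) (hD₀ : IsUnit D₀.det) (hc : ∀ j ≤ k, IsUnit (c j))
    (hQ : ∀ j ≤ k, Qs j * Qbs j = 1)
    (hF : ∀ j ≤ k, IsUnit (fluctuationOp (c j) (Qs j) (Qbs j) (flowD R 𝓘 c Qs Qbs D₀ j)).det) :
    flowD R 𝓘 c Qs Qbs D₀ (k + 1) * Qacc R 𝓘 Qs (k + 1) * D₀⁻¹ =
      c k • (Qs k * flowGamma R 𝓘 c Qs Qbs D₀ k * flowD R 𝓘 c Qs Qbs D₀ k * Qacc R 𝓘 Qs k *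
        D₀⁻¹) := by
  rw [← flowHb_eq R 𝓘 c Qs Qbs D₀ (k + 1) hD₀ (fun j hj => hc j (by omega))
      (fun j hj => hQ j (by omega)) (fun j hj => hF j (by omega)), flowHb,
    flowHb_eq R 𝓘 c Qs Qbs D₀ k hD₀ (fun j hj => hc j (by omega)) (fun j hj => hQ j (by omega))
      (fun j hj => hF j (by omega)), FermionBlockRG.fluctShiftBarMat, flowGamma, Matrix.smul_mul]
  simp only [Matrix.mul_assoc]

/-! ### §5 Theorem II.2: each fluctuation scale is a difference of two block terms -/

/-- **BOS THEOREM II.2 (tree form): `H_jΓ_jH̄_j = D⁻¹Q^*_jD_jQ_jD⁻¹ − D⁻¹Q^*_{j+1}D_{j+1}Q_{j+1}D⁻¹`**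
— the `j`-th fluctuation-scale term of Dimock's `S_k = Σ_j H_jΓ_jH̄_j` (50)–(51) telescopes.  BOS:
*"Proof of Theorem II.2 follows from Lemma II.4 d)–f)"* — literally: e), f) (`flowH_eq`, `flowHb_eq`),
d) (`inv_fluctuationOp_eq_sub`) and `Q^*_jQ̄_j = Q^*_{j+1}`, `Q_jQ_j = Q_{j+1}` (composites).
[cite: BalabanOcarrollSchor1989, §II Theorem II.2 p.239] -/
theorem flowH_mul_flowGamma_mul_flowHb (k : ℕ) (hD₀ : IsUnit D₀.det) (hc : ∀ j ≤ k, IsUnit (c j))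
    (hQ : ∀ j < k, Qs j * Qbs j = 1)
    (hF : ∀ j ≤ k, IsUnit (fluctuationOp (c j) (Qs j) (Qbs j) (flowD R 𝓘 c Qs Qbs D₀ j)).det) :
    flowH R 𝓘 c Qs Qbs D₀ k * flowGamma R 𝓘 c Qs Qbs D₀ k * flowHb R 𝓘 c Qs Qbs D₀ k =
      D₀⁻¹ * Qbacc R 𝓘 Qbs k * flowD R 𝓘 c Qs Qbs D₀ k * Qacc R 𝓘 Qs k * D₀⁻¹ -
        D₀⁻¹ * Qbacc R 𝓘 Qbs (k + 1) * flowD R 𝓘 c Qs Qbs D₀ (k + 1) * Qacc R 𝓘 Qs (k + 1) *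
          D₀⁻¹ := by
  have hc' : ∀ j < k, IsUnit (c j) := fun j hj => hc j hj.le
  have hF' : ∀ j < k,
      IsUnit (fluctuationOp (c j) (Qs j) (Qbs j) (flowD R 𝓘 c Qs Qbs D₀ j)).det :=
    fun j hj => hF j hj.le
  have hDk := isUnit_det_flowD R 𝓘 c Qs Qbs D₀ k hD₀ hc' hQ hF'
  rw [flowH_eq R 𝓘 c Qs Qbs D₀ k hD₀ hc' hQ hF', flowHb_eq R 𝓘 c Qs Qbs D₀ k hD₀ hc' hQ hF',
    flowGamma, inv_fluctuationOp_eq_sub (hc k le_rfl) (Qs k) (Qbs k) hDk (hF k le_rfl), ← flowD,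
    Qacc, Qbacc]
  simp only [Matrix.mul_sub, Matrix.sub_mul, Matrix.mul_assoc]
  rw [Matrix.mul_nonsing_inv_cancel_left _ _ hDk, Matrix.nonsing_inv_mul_cancel_left _ _ hDk,
    Matrix.mul_nonsing_inv_cancel_left _ _ hDk]

/-! ### §6 (2.5) = (1.5) and (1.6): the decomposition of the two-point function -/

/-- **BOS (2.5) = §I (1.5), the telescopic sum**: *"the overall structure of the decomposition of the
two-point function `D⁻¹` is trivial; the decomposition is the telescopic sum (letting `D_0 = D` and
`Q_0 = I`) `D⁻¹ = Σ_{j=0}^{k−1} [D⁻¹Q^*_jD_jQ_jD⁻¹ − D⁻¹Q^*_{j+1}D_{j+1}Q_{j+1}D⁻¹] + D⁻¹Q^*_kD_kQ_kD⁻¹`"*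
— hypothesis-free (`Finset.sum_range_sub'`; if `D₀` is not invertible both sides are `0`).
[cite: BalabanOcarrollSchor1989, §II (2.5) p.239, §I (1.5) p.234] -/
theorem inv_eq_sum_range_sub_add (k : ℕ) :
    D₀⁻¹ = (∑ j ∈ Finset.range k,
        (D₀⁻¹ * Qbacc R 𝓘 Qbs j * flowD R 𝓘 c Qs Qbs D₀ j * Qacc R 𝓘 Qs j * D₀⁻¹ -
          D₀⁻¹ * Qbacc R 𝓘 Qbs (j + 1) * flowD R 𝓘 c Qs Qbs D₀ (j + 1) * Qacc R 𝓘 Qs (j + 1) *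
            D₀⁻¹)) +
      D₀⁻¹ * Qbacc R 𝓘 Qbs k * flowD R 𝓘 c Qs Qbs D₀ k * Qacc R 𝓘 Qs k * D₀⁻¹ := by
  rw [Finset.sum_range_sub', Qbacc, Qacc, flowD, Matrix.mul_one, Matrix.mul_one, sub_add_cancel]
  by_cases hD₀ : IsUnit D₀.det
  · rw [Matrix.nonsing_inv_mul _ hD₀, Matrix.one_mul]
  · rw [Matrix.nonsing_inv_apply_not_isUnit _ hD₀, Matrix.zero_mul, Matrix.zero_mul]

/-- **BOS (1.6), THE DECOMPOSITION OF THE TWO-POINT FUNCTION: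
`D⁻¹ = Σ_{j=0}^{k−1} S_jΓ_jS̄^*_j + S_kD_k⁻¹S̄^*_k`** — in the tree's words
`D₀⁻¹ = flowS k + flowH k · (flowD k)⁻¹ · flowHb k`: the fine propagator is the sum of the `k`
fluctuation two-point functions dressed by the source couplings (Dimock's `S_k`, (50)) plus the block
propagator of level `k` dressed likewise (Theorem II.2 summed, (2.5)).
[cite: BalabanOcarrollSchor1989, §I (1.6) p.235, §II (2.5) p.239] -/
theorem inv_eq_flowS_add (k : ℕ) (hD₀ : IsUnit D₀.det) (hc : ∀ j < k, IsUnit (c j))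
    (hQ : ∀ j < k, Qs j * Qbs j = 1)
    (hF : ∀ j < k, IsUnit (fluctuationOp (c j) (Qs j) (Qbs j) (flowD R 𝓘 c Qs Qbs D₀ j)).det) :
    D₀⁻¹ = flowS R 𝓘 c Qs Qbs D₀ k +
      flowH R 𝓘 c Qs Qbs D₀ k * (flowD R 𝓘 c Qs Qbs D₀ k)⁻¹ * flowHb R 𝓘 c Qs Qbs D₀ k := by
  have hDk := isUnit_det_flowD R 𝓘 c Qs Qbs D₀ k hD₀ hc hQ hF
  rw [flowS_eq_sum, flowH_eq R 𝓘 c Qs Qbs D₀ k hD₀ hc hQ hF,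
    flowHb_eq R 𝓘 c Qs Qbs D₀ k hD₀ hc hQ hF]
  have hsum : ∑ j ∈ Finset.range k,
      flowH R 𝓘 c Qs Qbs D₀ j * flowGamma R 𝓘 c Qs Qbs D₀ j * flowHb R 𝓘 c Qs Qbs D₀ j =
      ∑ j ∈ Finset.range k,
        (D₀⁻¹ * Qbacc R 𝓘 Qbs j * flowD R 𝓘 c Qs Qbs D₀ j * Qacc R 𝓘 Qs j * D₀⁻¹ -
          D₀⁻¹ * Qbacc R 𝓘 Qbs (j + 1) * flowD R 𝓘 c Qs Qbs D₀ (j + 1) * Qacc R 𝓘 Qs (j + 1) *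
            D₀⁻¹) := by
    refine Finset.sum_congr rfl fun j hj => ?_
    have hj := Finset.mem_range.1 hj
    exact flowH_mul_flowGamma_mul_flowHb R 𝓘 c Qs Qbs D₀ j hD₀ (fun i hi => hc i (by omega))
      (fun i hi => hQ i (by omega)) (fun i hi => hF i (by omega))
  rw [hsum]
  have h3 : D₀⁻¹ * Qbacc R 𝓘 Qbs k * flowD R 𝓘 c Qs Qbs D₀ k * (flowD R 𝓘 c Qs Qbs D₀ k)⁻¹ *
      (flowD R 𝓘 c Qs Qbs D₀ k * Qacc R 𝓘 Qs k * D₀⁻¹) =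
      D₀⁻¹ * Qbacc R 𝓘 Qbs k * flowD R 𝓘 c Qs Qbs D₀ k * Qacc R 𝓘 Qs k * D₀⁻¹ := by
    rw [Matrix.mul_nonsing_inv_cancel_right _ _ hDk]
    simp only [Matrix.mul_assoc]
  rw [h3]
  exact inv_eq_sum_range_sub_add R 𝓘 c Qs Qbs D₀ k

/-! ### §7 Lemma II.4 a) and Theorem II.1 -/

/-- **BOS Lemma II.4 a), second line: `G^ε_k = D^{(0),ε−1} − D^{(0),ε−1}Q^*_kD^{(k),L^kε}Q_kD^{(0),ε−1}`**
(d) for the composite data, then Lemma II.2). [cite: BalabanOcarrollSchor1989, §II Lemma II.4 a) p.238] -/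
theorem fluctuationPropagator_acc_eq_sub (k : ℕ) {b : R} (hb : b * accInvWeight R c k = 1)
    (hD₀ : IsUnit D₀.det) (hc : ∀ j < k, IsUnit (c j)) (hQ : ∀ j < k, Qs j * Qbs j = 1)
    (hF : ∀ j < k, IsUnit (fluctuationOp (c j) (Qs j) (Qbs j) (flowD R 𝓘 c Qs Qbs D₀ j)).det) :
    fluctuationPropagator b (Qacc R 𝓘 Qs k) (Qbacc R 𝓘 Qbs k) D₀ =
      D₀⁻¹ - D₀⁻¹ * Qbacc R 𝓘 Qbs k * flowD R 𝓘 c Qs Qbs D₀ k * Qacc R 𝓘 Qs k * D₀⁻¹ := by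
  rw [fluctuationPropagator, inv_fluctuationOp_eq_sub (IsUnit.of_mul_eq_one _ hb) _ _ hD₀
    (isUnit_det_fluctuationOp_acc R 𝓘 c Qs Qbs D₀ k hb hD₀ hc hQ hF),
    ← flowD_eq_blockDirac_acc R 𝓘 c Qs Qbs D₀ k hb hD₀ hc hQ hF]

/-- **BOS Lemma II.4 a), first line:
`G^ε_k = D^{(0),ε−1} − a_k(L^kε)⁻¹D^{(0),ε−1}Q^*_k(I + a_k(L^kε)⁻¹Q_kD^{(0),ε−1}Q^*_k)⁻¹Q_kD^{(0),ε−1}`**.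
[cite: BalabanOcarrollSchor1989, §II Lemma II.4 a) p.238] -/
theorem fluctuationPropagator_acc_eq_sub' (k : ℕ) {b : R} (hb : b * accInvWeight R c k = 1)
    (hD₀ : IsUnit D₀.det) (hc : ∀ j < k, IsUnit (c j)) (hQ : ∀ j < k, Qs j * Qbs j = 1)
    (hF : ∀ j < k, IsUnit (fluctuationOp (c j) (Qs j) (Qbs j) (flowD R 𝓘 c Qs Qbs D₀ j)).det) :
    fluctuationPropagator b (Qacc R 𝓘 Qs k) (Qbacc R 𝓘 Qbs k) D₀ =
      D₀⁻¹ - b • (D₀⁻¹ * Qbacc R 𝓘 Qbs k *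
        (1 + b • (Qacc R 𝓘 Qs k * D₀⁻¹ * Qbacc R 𝓘 Qbs k))⁻¹ * Qacc R 𝓘 Qs k * D₀⁻¹) := by
  rw [fluctuationPropagator_acc_eq_sub R 𝓘 c Qs Qbs D₀ k hb hD₀ hc hQ hF,
    flowD_eq_smul_inv R 𝓘 c Qs Qbs D₀ k hb hD₀ hc hQ hF, Matrix.mul_smul, Matrix.smul_mul,
    Matrix.smul_mul]

/-- **BOS THEOREM II.1 a): `Z^ε_{k+1} = Z^ε_kZ^{(k),L^kε}`, or in iterated form
`Z_k = Z^{(k−1),L^{k−1}ε}⋯Z^{(1),Lε}Z^{(0),ε}`** — the tree's `flowZ k` is the product of the one-step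
constants `ε_j det(−(D_j + c_jQ̄_jQ_j))` (Dimock (48) with the tree's unnormalised Berezin integral).
[cite: BalabanOcarrollSchor1989, §II Theorem II.1 a) p.238] -/
theorem flowZ_eq_prod (k : ℕ) :
    flowZ R 𝓘 c Qs Qbs D₀ k = ∏ j ∈ Finset.range k,
      ((-1 : R) ^ (Fintype.card (𝓘 j) * (Fintype.card (𝓘 j) - 1) / 2) *
        (-fluctuationOp (c j) (Qs j) (Qbs j) (flowD R 𝓘 c Qs Qbs D₀ j)).det) := by
  induction k with
  | zero => rw [flowZ, Finset.prod_range_zero]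
  | succ k ih => rw [flowZ, ih, Finset.prod_range_succ]

/-- **BOS THEOREM II.1 c), iterated form ∕ Theorem II.1c + Lemma II.4a: `G^ε_k = Σ_{j<k} H_jΓ_jH̄_j`**
— the composite fluctuation propagator `(D₀ + a_k(L^kε)⁻¹Q^*_kQ_k)⁻¹` of (2.2) EQUALS the accumulated
two-point matrix `flowS k` of the tree's flow (Dimock's two descriptions of `S_k(A)`: (40)
`S_k = (D#_k)⁻¹` with the `k`-fold average, and (50) `S_k = Σ_j Γ̃_j`; BOS:
*"`G^ε_k = Σ_{j=1}^{k−1} a_j²(L^jε)⁻²G^ε_jQ^*_jΓ^{(j)}Q_jG^ε_j + Γ^{(0),ε}`"* with e), f)).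
[cite: BalabanOcarrollSchor1989, §II Theorem II.1 c) p.238] -/
theorem fluctuationPropagator_acc_eq_flowS (k : ℕ) {b : R} (hb : b * accInvWeight R c k = 1)
    (hD₀ : IsUnit D₀.det) (hc : ∀ j < k, IsUnit (c j)) (hQ : ∀ j < k, Qs j * Qbs j = 1)
    (hF : ∀ j < k, IsUnit (fluctuationOp (c j) (Qs j) (Qbs j) (flowD R 𝓘 c Qs Qbs D₀ j)).det) :
    fluctuationPropagator b (Qacc R 𝓘 Qs k) (Qbacc R 𝓘 Qbs k) D₀ = flowS R 𝓘 c Qs Qbs D₀ k := by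
  have hDk := isUnit_det_flowD R 𝓘 c Qs Qbs D₀ k hD₀ hc hQ hF
  rw [fluctuationPropagator_acc_eq_sub R 𝓘 c Qs Qbs D₀ k hb hD₀ hc hQ hF, sub_eq_iff_eq_add]
  have h := inv_eq_flowS_add R 𝓘 c Qs Qbs D₀ k hD₀ hc hQ hF
  rw [flowH_eq R 𝓘 c Qs Qbs D₀ k hD₀ hc hQ hF, flowHb_eq R 𝓘 c Qs Qbs D₀ k hD₀ hc hQ hF,
    Matrix.mul_nonsing_inv_cancel_right _ _ hDk] at h
  simpa only [Matrix.mul_assoc] using h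

/-- **BOS THEOREM II.2 as printed:
`a_j²(L^jε)⁻²G^ε_jQ^*_jΓ^{(j),L^jε}Q_jG^ε_j = D^{(0),ε−1}Q^*_jD^{(j),L^jε}Q_jD^{(0),ε−1} − D^{(0),ε−1}Q^*_{j+1}D^{(j+1),L^{j+1}ε}Q_{j+1}D^{(0),ε−1}`**
(`b` a composite weight of level `j`; the tree form `flowH_mul_flowGamma_mul_flowHb` with e), f)).
[cite: BalabanOcarrollSchor1989, §II Theorem II.2 p.239] -/
theorem sq_smul_fluctuationPropagator_acc_conj_eq_sub (k : ℕ) {b : R}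
    (hb : b * accInvWeight R c k = 1) (hD₀ : IsUnit D₀.det) (hc : ∀ j ≤ k, IsUnit (c j))
    (hQ : ∀ j < k, Qs j * Qbs j = 1)
    (hF : ∀ j ≤ k, IsUnit (fluctuationOp (c j) (Qs j) (Qbs j) (flowD R 𝓘 c Qs Qbs D₀ j)).det) :
    b ^ 2 • (fluctuationPropagator b (Qacc R 𝓘 Qs k) (Qbacc R 𝓘 Qbs k) D₀ * Qbacc R 𝓘 Qbs k *
        flowGamma R 𝓘 c Qs Qbs D₀ k * Qacc R 𝓘 Qs k *
        fluctuationPropagator b (Qacc R 𝓘 Qs k) (Qbacc R 𝓘 Qbs k) D₀) =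
      D₀⁻¹ * Qbacc R 𝓘 Qbs k * flowD R 𝓘 c Qs Qbs D₀ k * Qacc R 𝓘 Qs k * D₀⁻¹ -
        D₀⁻¹ * Qbacc R 𝓘 Qbs (k + 1) * flowD R 𝓘 c Qs Qbs D₀ (k + 1) * Qacc R 𝓘 Qs (k + 1) *
          D₀⁻¹ := by
  have hc' : ∀ j < k, IsUnit (c j) := fun j hj => hc j hj.le
  have hF' : ∀ j < k,
      IsUnit (fluctuationOp (c j) (Qs j) (Qbs j) (flowD R 𝓘 c Qs Qbs D₀ j)).det :=
    fun j hj => hF j hj.le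
  rw [← flowH_mul_flowGamma_mul_flowHb R 𝓘 c Qs Qbs D₀ k hD₀ hc hQ hF,
    flowH_eq_smul R 𝓘 c Qs Qbs D₀ k hb hD₀ hc' hQ hF', flowHb_eq R 𝓘 c Qs Qbs D₀ k hD₀ hc' hQ hF',
    ← smul_Qacc_mul_fluctuationPropagator_acc R 𝓘 c Qs Qbs D₀ k hb hD₀ hc' hQ hF', pow_two,
    ← smul_smul, Matrix.smul_mul, Matrix.smul_mul, Matrix.mul_smul]
  simp only [Matrix.mul_assoc]

/-- **BOS THEOREM II.1 c), first step: `G_1 = Γ^{(0),ε}`** — after one step the composite data are the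
one-step data (`Q_1 = Q`, `a_1(Lε)⁻¹ = a(Lε)⁻¹ = c 0`). [cite: BalabanOcarrollSchor1989, §II Theorem II.1 c) p.238] -/
theorem fluctuationPropagator_acc_one :
    fluctuationPropagator (c 0) (Qacc R 𝓘 Qs 1) (Qbacc R 𝓘 Qbs 1) D₀ =
      flowGamma R 𝓘 c Qs Qbs D₀ 0 := by
  rw [fluctuationPropagator, flowGamma, Qacc, Qbacc, Qacc, Qbacc, Matrix.mul_one, Matrix.one_mul,
    flowD]

/-- **BOS THEOREM II.1 c), one step: `G^ε_{k+1} = a_k²(L^kε)⁻²G^ε_kQ^*_kΓ^{(k),L^kε}Q_kG^ε_k + G^ε_k`**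
(`b`, `b'` composite weights of levels `k`, `k + 1`). [cite: BalabanOcarrollSchor1989, §II Theorem II.1 c) p.238] -/
theorem fluctuationPropagator_acc_succ (k : ℕ) {b b' : R} (hb : b * accInvWeight R c k = 1)
    (hb' : b' * accInvWeight R c (k + 1) = 1) (hD₀ : IsUnit D₀.det)
    (hc : ∀ j ≤ k, IsUnit (c j)) (hQ : ∀ j ≤ k, Qs j * Qbs j = 1)
    (hF : ∀ j ≤ k, IsUnit (fluctuationOp (c j) (Qs j) (Qbs j) (flowD R 𝓘 c Qs Qbs D₀ j)).det) :
    fluctuationPropagator b' (Qacc R 𝓘 Qs (k + 1)) (Qbacc R 𝓘 Qbs (k + 1)) D₀ =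
      b ^ 2 • (fluctuationPropagator b (Qacc R 𝓘 Qs k) (Qbacc R 𝓘 Qbs k) D₀ * Qbacc R 𝓘 Qbs k *
        flowGamma R 𝓘 c Qs Qbs D₀ k * Qacc R 𝓘 Qs k *
        fluctuationPropagator b (Qacc R 𝓘 Qs k) (Qbacc R 𝓘 Qbs k) D₀) +
      fluctuationPropagator b (Qacc R 𝓘 Qs k) (Qbacc R 𝓘 Qbs k) D₀ := by
  have hc' : ∀ j < k, IsUnit (c j) := fun j hj => hc j hj.le
  have hQ' : ∀ j < k, Qs j * Qbs j = 1 := fun j hj => hQ j hj.le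
  have hF' : ∀ j < k,
      IsUnit (fluctuationOp (c j) (Qs j) (Qbs j) (flowD R 𝓘 c Qs Qbs D₀ j)).det :=
    fun j hj => hF j hj.le
  rw [fluctuationPropagator_acc_eq_flowS R 𝓘 c Qs Qbs D₀ (k + 1) hb' hD₀ (fun j hj => hc j (by omega))
      (fun j hj => hQ j (by omega)) (fun j hj => hF j (by omega)), flowS,
    sq_smul_fluctuationPropagator_acc_conj_eq_sub R 𝓘 c Qs Qbs D₀ k hb hD₀ hc hQ' hF,
    ← flowH_mul_flowGamma_mul_flowHb R 𝓘 c Qs Qbs D₀ k hD₀ hc hQ' hF,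
    fluctuationPropagator_acc_eq_flowS R 𝓘 c Qs Qbs D₀ k hb hD₀ hc' hQ' hF', add_comm]

/-- **BOS THEOREM II.1 b), first formula:
`a_{k+1}(L^{k+1}ε)⁻¹Q_{k+1}G^ε_{k+1} = a(L^{k+1}ε)⁻¹a_k(L^kε)⁻¹QΓ^{(k),L^kε}Q_kG^ε_k`** (f) at both levels
and the recursion of `flowHb`). [cite: BalabanOcarrollSchor1989, §II Theorem II.1 b) p.238] -/
theorem smul_Qacc_succ_mul_fluctuationPropagator_acc (k : ℕ) {b b' : R}
    (hb : b * accInvWeight R c k = 1) (hb' : b' * accInvWeight R c (k + 1) = 1)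
    (hD₀ : IsUnit D₀.det) (hc : ∀ j ≤ k, IsUnit (c j)) (hQ : ∀ j ≤ k, Qs j * Qbs j = 1)
    (hF : ∀ j ≤ k, IsUnit (fluctuationOp (c j) (Qs j) (Qbs j) (flowD R 𝓘 c Qs Qbs D₀ j)).det) :
    b' • (Qacc R 𝓘 Qs (k + 1) *
        fluctuationPropagator b' (Qacc R 𝓘 Qs (k + 1)) (Qbacc R 𝓘 Qbs (k + 1)) D₀) =
      (c k * b) • (Qs k * flowGamma R 𝓘 c Qs Qbs D₀ k * Qacc R 𝓘 Qs k *
        fluctuationPropagator b (Qacc R 𝓘 Qs k) (Qbacc R 𝓘 Qbs k) D₀) := by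
  have hc' : ∀ j < k, IsUnit (c j) := fun j hj => hc j hj.le
  have hQ' : ∀ j < k, Qs j * Qbs j = 1 := fun j hj => hQ j hj.le
  have hF' : ∀ j < k,
      IsUnit (fluctuationOp (c j) (Qs j) (Qbs j) (flowD R 𝓘 c Qs Qbs D₀ j)).det :=
    fun j hj => hF j hj.le
  rw [smul_Qacc_mul_fluctuationPropagator_acc R 𝓘 c Qs Qbs D₀ (k + 1) hb' hD₀
      (fun j hj => hc j (by omega)) (fun j hj => hQ j (by omega)) (fun j hj => hF j (by omega)),
    ← flowHb_eq R 𝓘 c Qs Qbs D₀ (k + 1) hD₀ (fun j hj => hc j (by omega))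
      (fun j hj => hQ j (by omega)) (fun j hj => hF j (by omega)), flowHb,
    flowHb_eq R 𝓘 c Qs Qbs D₀ k hD₀ hc' hQ' hF',
    ← smul_Qacc_mul_fluctuationPropagator_acc R 𝓘 c Qs Qbs D₀ k hb hD₀ hc' hQ' hF',
    FermionBlockRG.fluctShiftBarMat, flowGamma, ← smul_smul, Matrix.smul_mul, Matrix.mul_smul]
  simp only [Matrix.mul_assoc]

/-- **BOS THEOREM II.1 b), second formula:
`a_{k+1}(L^{k+1}ε)⁻¹G^ε_{k+1}Q^*_{k+1} = a(L^{k+1}ε)⁻¹a_k(L^kε)⁻¹G^ε_kQ^*_kΓ^{(k),L^kε}Q^*`** (e) at both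
levels and the recursion of `flowH`). [cite: BalabanOcarrollSchor1989, §II Theorem II.1 b) p.238] -/
theorem smul_fluctuationPropagator_acc_succ_mul_Qbacc (k : ℕ) {b b' : R}
    (hb : b * accInvWeight R c k = 1) (hb' : b' * accInvWeight R c (k + 1) = 1)
    (hD₀ : IsUnit D₀.det) (hc : ∀ j ≤ k, IsUnit (c j)) (hQ : ∀ j ≤ k, Qs j * Qbs j = 1)
    (hF : ∀ j ≤ k, IsUnit (fluctuationOp (c j) (Qs j) (Qbs j) (flowD R 𝓘 c Qs Qbs D₀ j)).det) :
    b' • (fluctuationPropagator b' (Qacc R 𝓘 Qs (k + 1)) (Qbacc R 𝓘 Qbs (k + 1)) D₀ *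
        Qbacc R 𝓘 Qbs (k + 1)) =
      (c k * b) • (fluctuationPropagator b (Qacc R 𝓘 Qs k) (Qbacc R 𝓘 Qbs k) D₀ * Qbacc R 𝓘 Qbs k *
        flowGamma R 𝓘 c Qs Qbs D₀ k * Qbs k) := by
  have hc' : ∀ j < k, IsUnit (c j) := fun j hj => hc j hj.le
  have hQ' : ∀ j < k, Qs j * Qbs j = 1 := fun j hj => hQ j hj.le
  have hF' : ∀ j < k,
      IsUnit (fluctuationOp (c j) (Qs j) (Qbs j) (flowD R 𝓘 c Qs Qbs D₀ j)).det :=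
    fun j hj => hF j hj.le
  rw [← flowH_eq_smul R 𝓘 c Qs Qbs D₀ (k + 1) hb' hD₀ (fun j hj => hc j (by omega))
      (fun j hj => hQ j (by omega)) (fun j hj => hF j (by omega)), flowH,
    flowH_eq_smul R 𝓘 c Qs Qbs D₀ k hb hD₀ hc' hQ' hF', FermionBlockRG.fluctShiftMat, flowGamma,
    mul_comm (c k) b, ← smul_smul, Matrix.smul_mul, Matrix.mul_smul]
  simp only [Matrix.mul_assoc]

/-! ### §8 The Grassmann reading: (2.1) iterated, the composite transformation, and (2.4) -/

section Grassmann

variable [Algebra ℚ R]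

/-- **BOS (2.1) iterated: `Z_k e^{(ψ̄,D^{(k)}ψ)} = T^{L^{k−1}ε}_{a,L}⋯T^ε_{a,L}(e^{(φ̄,Dφ)})`** in the
tree's conventions — `k` block-spin steps of the tree's transformation applied to the Gaussian
`e^{−ψ̄D₀ψ}` give `flowZ k • e^{−χ̄ (flowD k) χ}` (each step the tree's
`fermionBlockRG_grassmannExp_quadratic`; the inductive definition (2.1) of `D^{(k+1)}`, `Z^{(k)}` is
the tree's `flowD`, `flowZ`). [cite: BalabanOcarrollSchor1989, §II (2.1) p.237] -/
theorem towerT_grassmannExp_quadratic (k : ℕ)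
    (hF : ∀ j < k, IsUnit (fluctuationOp (c j) (Qs j) (Qbs j) (flowD R 𝓘 c Qs Qbs D₀ j)).det) :
    towerT R 𝓘 Qs Qbs c (grassmannExp (quadratic R (-D₀))) k =
      flowZ R 𝓘 c Qs Qbs D₀ k • grassmannExp (quadratic R (-flowD R 𝓘 c Qs Qbs D₀ k)) := by
  induction k with
  | zero => rw [towerT, flowZ, flowD, one_smul]
  | succ k ih =>
    rw [towerT, ih fun j hj => hF j (by omega), map_smul,
      fermionBlockRG_grassmannExp_quadratic R _ _ _ _ (hF k (by omega)), smul_smul, flowZ, flowD]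

/-- **The display of the proof of Lemma II.2, `Z^ε_k e^{(ψ̄,D^{(k)}ψ)} = T^ε_{a_k,L^k}(e^{(φ̄,D^{(0),ε}φ)})`,
in the tree's conventions**: the ONE composite transformation `T_{bacc k, Q_{k+1}, Q^*_{k+1}}` (the
right-hand side of `FermionBlockRGComposition.towerT_succ`) maps the Gaussian `e^{−ψ̄D₀ψ}` to
`ε det(−(D₀ + bacc k·Q^*_{k+1}Q_{k+1})) • e^{−χ̄ (flowD (k+1)) χ}` — the tree's one-step evaluation for
the composite data, with Lemma II.2 identifying the exponent. [cite: BalabanOcarrollSchor1989, §II Lemma II.2 (proof) p.237] -/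
theorem fermionBlockRG_acc_grassmannExp_quadratic (k : ℕ) (hD₀ : IsUnit D₀.det)
    (hc : ∀ j ≤ k, IsUnit (c j)) (hbc : ∀ j < k, IsUnit (bacc R c j + c (j + 1)))
    (hQ : ∀ j ≤ k, Qs j * Qbs j = 1)
    (hF : ∀ j ≤ k, IsUnit (fluctuationOp (c j) (Qs j) (Qbs j) (flowD R 𝓘 c Qs Qbs D₀ j)).det) :
    fermionBlockRG R (bacc R c k) (Qacc R 𝓘 Qs (k + 1)) (Qbacc R 𝓘 Qbs (k + 1))
        (grassmannExp (quadratic R (-D₀))) =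
      ((-1 : R) ^ (Fintype.card (𝓘 0) * (Fintype.card (𝓘 0) - 1) / 2) *
          (-fluctuationOp (bacc R c k) (Qacc R 𝓘 Qs (k + 1)) (Qbacc R 𝓘 Qbs (k + 1)) D₀).det) •
        grassmannExp (quadratic R (-flowD R 𝓘 c Qs Qbs D₀ (k + 1))) := by
  rw [flowD_succ_eq_blockDirac_bacc R 𝓘 c Qs Qbs D₀ k hD₀ hc hbc hQ hF]
  exact fermionBlockRG_grassmannExp_quadratic R _ _ _ _
    (isUnit_det_fluctuationOp_acc R 𝓘 c Qs Qbs D₀ (k + 1) (bacc_mul_accInvWeight_succ R c k hc hbc)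
      hD₀ (fun j hj => hc j (by omega)) (fun j hj => hQ j (by omega)) (fun j hj => hF j (by omega)))

variable {J : Type*} [LinearOrder J] [Fintype J]
variable (es : (k : ℕ) → 𝓘 k ⊕ₗ 𝓘 k ↪o J) (vbar v : 𝓘 0 → J → R)

/-- **BOS (2.4) in the tree's conventions** (`T^ε_{a_k,L^k}(e^{(φ̄,Dφ)+(φ̄,f)+(f̄,φ)})
= Z^ε_k e^{(ψ̄,D^{(k)}ψ)} e^{a_k(L^kε)⁻¹[(ψ̄,Q_kG^ε_kf)+(f̄,G^ε_kQ^*_kψ)]} e^{−(f̄,G^ε_kf)}`): the `k`-fold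
block-spin integral of the Gaussian with sources (the tree's `iterGeneratingFn`, Dimock (43)∕(45)
iterated) is the generating function (44) with its data IN CLOSED FORM — action `flowD k = D^{(k)}`,
source couplings `a_k(L^kε)⁻¹G^ε_kQ^*_k` (`= D⁻¹Q^*_kD^{(k)}`) and `a_k(L^kε)⁻¹Q_kG^ε_k` (`= D^{(k)}Q_kD⁻¹`),
source two-point matrix `G^ε_k` (the tree's sign conventions `e^{−ψ̄Dψ}`, `e^{+(η̄,Sη)}` replace BOS's
`e^{+(ψ̄,Dψ)}`, `e^{−(f̄,Gf)}`). [cite: BalabanOcarrollSchor1989, §II (2.4) p.237] -/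
theorem iterGeneratingFn_eq_generatingFn_acc (hes : ∀ k x y, es (k + 1) x ≠ es k y)
    (hvbar : ∀ i k l, vbar i (es k l) = 0) (hv : ∀ i k l, v i (es k l) = 0) (k : ℕ) {b : R}
    (hb : b * accInvWeight R c k = 1) (hD₀ : IsUnit D₀.det) (hc : ∀ j < k, IsUnit (c j))
    (hQ : ∀ j < k, Qs j * Qbs j = 1)
    (hF : ∀ j < k, IsUnit (fluctuationOp (c j) (Qs j) (Qbs j) (flowD R 𝓘 c Qs Qbs D₀ j)).det) :
    iterGeneratingFn R 𝓘 c Qs Qbs D₀ es vbar v k =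
      generatingFn R (flowZ R 𝓘 c Qs Qbs D₀ k) (flowD R 𝓘 c Qs Qbs D₀ k)
        (b • (fluctuationPropagator b (Qacc R 𝓘 Qs k) (Qbacc R 𝓘 Qbs k) D₀ * Qbacc R 𝓘 Qbs k))
        (b • (Qacc R 𝓘 Qs k * fluctuationPropagator b (Qacc R 𝓘 Qs k) (Qbacc R 𝓘 Qbs k) D₀))
        (fluctuationPropagator b (Qacc R 𝓘 Qs k) (Qbacc R 𝓘 Qbs k) D₀)
        (psiBarOf R (es k)) (psiOf R (es k)) (fun i => ι R (vbar i)) (fun j => ι R (v j)) := by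
  rw [iterGeneratingFn_eq_generatingFn R 𝓘 c Qs Qbs D₀ es vbar v hes hvbar hv k hF,
    ← flowH_eq_smul R 𝓘 c Qs Qbs D₀ k hb hD₀ hc hQ hF,
    ← flowHb_eq_smul R 𝓘 c Qs Qbs D₀ k hb hD₀ hc hQ hF,
    fluctuationPropagator_acc_eq_flowS R 𝓘 c Qs Qbs D₀ k hb hD₀ hc hQ hF]

/-- Scalar cancellation against a Grassmann exponential: `u • eˣ = v • eˣ ⇒ u = v` for nilpotent `x`
(`eˣ` is a unit and `R → Λ` is injective). [folklore] -/
private theorem smul_grassmannExp_cancel {ι' : Type*} {x : GrassmannAlgebra R ι'} (hx : IsNilpotent x)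
    {u v : R} (h : u • grassmannExp x = v • grassmannExp x) : u = v := by
  have hE : IsUnit (grassmannExp x) := IsNilpotent.isUnit_exp hx
  obtain ⟨E, hEeq⟩ := hE
  have h1 : (u - v) • (1 : GrassmannAlgebra R ι') = 0 := by
    have : (u - v) • grassmannExp x = 0 := by rw [sub_smul, h, sub_self]
    rw [← hEeq] at this
    calc (u - v) • (1 : GrassmannAlgebra R ι')
        = ((u - v) • (E : GrassmannAlgebra R ι')) * ↑E⁻¹ := by rw [smul_mul_assoc, Units.mul_inv]
      _ = 0 := by rw [this, zero_mul]
  have h2 : algebraMap R (GrassmannAlgebra R ι') (u - v) = 0 := by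
    rw [Algebra.algebraMap_eq_smul_one, h1]
  have h3 : u - v = 0 := by
    have := congrArg ExteriorAlgebra.algebraMapInv h2
    simpa using this
  exact sub_eq_zero.1 h3

/-- **BOS THEOREM II.1 a) in substance: `Z^ε_{k+1} = Z^ε_kZ^{(k),L^kε}`, i.e. the constant of the
COMPOSITE transformation is the product of the one-step constants.**  In the tree: the `k + 1` one-step
transformations applied to the Gaussian `e^{−ψ̄D₀ψ}` produce `flowZ (k+1) • e^{−χ̄D_{k+1}χ}` ((2.1)
iterated, `towerT_grassmannExp_quadratic`); by BOS Lemma II.1 in iterated form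
(`FermionBlockRGComposition.towerT_succ`) they are `accConst k •` ONE composite transformation
`T_{bacc k, Q_{k+1}, Q^*_{k+1}}`, which produces `ε₀ det(−(D₀ + bacc k·Q^*_{k+1}Q_{k+1})) • e^{−χ̄D_{k+1}χ}`
(`fermionBlockRG_acc_grassmannExp_quadratic`, Lemma II.2); cancelling the unit `e^{−χ̄D_{k+1}χ}`:
`accConst k · ε₀ det(−(G^ε_{k+1})⁻¹) = flowZ (k+1)` (*"which defines `Z^ε_k`. … a) `Z^ε_{k+1} = Z^ε_kZ^{(k),L^kε}`,
or in iterated form `Z_k = Z^{(k−1),L^{k−1}ε}⋯Z^{(1),Lε}Z^{(0),ε}`"*).  Hypotheses as in `towerT_succ`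
(for all levels: `Q_jQ̄_j = 1`, `bacc_j`, `bacc_j + c_{j+1}` units) plus `D₀`, `c_j`, `F_j` (`j ≤ k`).
[cite: BalabanOcarrollSchor1989, §II Theorem II.1 a), (2.4) pp.237–238] -/
theorem accConst_mul_eq_flowZ (hQ : ∀ j, Qs j * Qbs j = 1) (hb : ∀ j, IsUnit (bacc R c j))
    (hbc : ∀ j, IsUnit (bacc R c j + c (j + 1))) (k : ℕ) (hD₀ : IsUnit D₀.det)
    (hc : ∀ j ≤ k, IsUnit (c j))
    (hF : ∀ j ≤ k, IsUnit (fluctuationOp (c j) (Qs j) (Qbs j) (flowD R 𝓘 c Qs Qbs D₀ j)).det) :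
    accConst R Qs Qbs c k *
        ((-1 : R) ^ (Fintype.card (𝓘 0) * (Fintype.card (𝓘 0) - 1) / 2) *
          (-fluctuationOp (bacc R c k) (Qacc R 𝓘 Qs (k + 1)) (Qbacc R 𝓘 Qbs (k + 1)) D₀).det) =
      flowZ R 𝓘 c Qs Qbs D₀ (k + 1) := by
  have h := towerT_succ R hQ hb hbc (grassmannExp (quadratic R (-D₀))) k
  rw [towerT_grassmannExp_quadratic R 𝓘 c Qs Qbs D₀ (k + 1) (fun j hj => hF j (by omega)),
    fermionBlockRG_acc_grassmannExp_quadratic R 𝓘 c Qs Qbs D₀ k hD₀ hc (fun j _ => hbc j)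
      (fun j _ => hQ j) hF, smul_smul] at h
  exact (smul_grassmannExp_cancel R (isNilpotent_quadratic R _) h).symm

end Grassmann

end FermionBlockRG

end QLatticeAQFT

end Literature.MathematicalPhysics.QuantumLattice
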